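import Literature.Dynamics.Ergodic.AuxiliaryFunctionDuality
import HarnessLib

/-!
# Sharpness of the auxiliary-function method (Tobasco–Goluskin–Doering 2018) — proof

Topic `Literature/Dynamics/Ergodic`. This file PROVES the named fact of
`Literature/Dynamics/Ergodic/AuxiliaryFunctionDuality.lean`:
`TobascoGoluskinDoering2018_measureForm_holds : TobascoGoluskinDoering2018_measureForm`
(I. Tobasco, D. Goluskin, C. R. Doering, *Optimal bounds and extremal trajectories for time
averages in nonlinear dynamical systems*, Phys. Lett. A 382 (2018) 382–386 = arXiv:1705.07096,
eq. (8) with (10a) and (11)). It is a sibling `…Proofs` module so that the statement file stays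
light; nothing here is a definition or a new named fact.

## The printed proof (§5) and the road taken here

The paper proves (8) through the chain (10a)–(10d):
`max_{x₀} Φ̄ = max_{μ invariant} ∫Φ dμ = sup_μ inf_V ∫(Φ + F·∇V) dμ = inf_V sup_μ ∫(Φ + F·∇V) dμ
 = inf_V max_B (Φ + F·∇V)`, using (i) Krylov–Bogolyubov, extreme points of the invariant measures
and Birkhoff's ergodic theorem for (10a); (ii) the equivalence of Lagrangian invariance and the
Eulerian condition `∫ F·∇ψ dμ = 0`, (11)–(12), proved with the `C¹` flow map; (iii) Sion's
minimax theorem for (10c). Mathlib (2026-08) has neither Sion's theorem, nor the differentiable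
dependence of ODE flows on initial data, nor Birkhoff's theorem for flows, so the three analytic
inputs are replaced by the following self-contained arguments (same statement, same constants):

* **W (weak duality, the paper's (4)–(6))** `V(x(T)) − V(x(0)) = ∫₀ᵀ F·∇V(x(t)) dt` along a
  forward trajectory (chain rule + FTC), hence `T⁻¹∫₀ᵀ Φ(x) ≤ sup_B (Φ + F·∇V) + 2‖V‖_B / T`.
* **F (the flow on `B`)** uniqueness (Grönwall, `ODE_solution_unique_of_mem_Icc_right`), the
  semigroup identity, Lipschitz dependence on the initial point
  (`dist_le_of_trajectories_ODE_of_mem`) and the speed bound — all on `B` only.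
* **H (strong duality for measures, replacing Sion (10c))** the sublinear functional
  `N(h) = inf_{V ∈ C¹(B)} sup_B (h + F·∇V)` on `C(B)`; Hahn–Banach
  (`exists_extension_of_le_sublinear`) gives a linear `ℓ ≤ N` with `ℓ(Φ) = N(Φ)`; `ℓ` is positive,
  normalised and kills every `F·∇ψ`, so by Riesz–Markov–Kakutani (`RealRMK.rieszMeasure`) it is an
  Eulerian-stationary probability measure `μ` on `B` with `∫Φ dμ = inf_V sup_B (Φ + F·∇V)`.
* **K (Eulerian ⇒ Lagrangian, replacing (11)–(12))** for an Eulerian-stationary `ν` and `T > 0`,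
  `∫Φ dν ≤ T⁻¹ max_{b ∈ B} ∫₀ᵀ Φ(φ_s b) ds`: with `Φ̃` a smooth uniform approximation of `Φ` on `B`,
  `V(b) = ∫₀ᵀ (1 − s/T) Φ̃(φ_s b) ds` is Lipschitz on `B` with uniform flow-derivative
  `T⁻¹∫₀ᵀ Φ̃(φ_s b) ds − Φ̃(b)`; a McShane extension of `V`, mollified and cut off, is a legitimate
  test function `ψ`, and a difference-quotient estimate that only uses the flow ON `B` and the
  Lipschitz continuity of `F` near `B` bounds `F·∇ψ` on `B` from above by that flow-derivative
  plus a small error; integrating against `ν` gives the inequality.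
* **E (a maximal trajectory, replacing extreme points + Birkhoff for (10a))** with
  `m = inf_V sup_B(Φ + F·∇V)`, H+K give `max_b ∫₀ᵀ (Φ − m)(φ_s b) ds ≥ 0` for every `T`; if every
  `b ∈ B` had a time `T_b` with `∫₀^{T_b} (Φ − m)(φ_s b) ds < −1`, compactness would make `T_b`
  uniformly bounded and iterating along one orbit would make `∫₀ᵀ (Φ − m) < 0` for large `T`,
  a contradiction; so some orbit has `∫₀ᵀ (Φ − m)(φ_s b) ds ≥ −C` for all `T`, i.e.
  `liminf` of its time averages is `≥ m`, and by W its `limsup` is `≤ m`.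

## References

* I. Tobasco, D. Goluskin, C. R. Doering, *Optimal bounds and extremal trajectories for time
  averages in nonlinear dynamical systems*, Phys. Lett. A 382 (2018) 382–386, arXiv:1705.07096,
  §2 (4)–(8), §5 (10a)–(13). [TobascoGoluskinDoering2018]
* N. Kryloff, N. Bogoliouboff, Ann. of Math. 38 (1937) 65–113 (invariant measures).
-/

noncomputable section

namespace Literature.Dynamics.Ergodic

open _root_.MeasureTheory Filter Set Metric
open scoped Topology NNReal Interval Pointwise

variable {d : ℕ}

section WeakDuality

variable {F : EuclideanSpace ℝ (Fin d) → EuclideanSpace ℝ (Fin d)}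
  {B : Set (EuclideanSpace ℝ (Fin d))} {Φ : EuclideanSpace ℝ (Fin d) → ℝ}
  {V : EuclideanSpace ℝ (Fin d) → ℝ} {x : ℝ → EuclideanSpace ℝ (Fin d)}

/-- A forward trajectory is continuous on `[0, ∞)`. [folklore] -/
theorem IsForwardTrajectoryIn.continuousOn_Ici (hx : IsForwardTrajectoryIn F B x) :
    ContinuousOn x (Ici 0) :=
  fun t ht => (hx.2.1 t ht).continuousWithinAt

/-- A forward trajectory has right derivative `F (x t)` at every `t ≥ 0`. [folklore] -/
theorem IsForwardTrajectoryIn.hasDerivWithinAt_Ici (hx : IsForwardTrajectoryIn F B x) {t : ℝ}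
    (ht : 0 ≤ t) : HasDerivWithinAt x (F (x t)) (Ici t) t :=
  (hx.2.1 t ht).mono (Ici_subset_Ici.2 ht)

/-- A forward trajectory in `B` stays in `B`. [folklore] -/
theorem IsForwardTrajectoryIn.mem (hx : IsForwardTrajectoryIn F B x) {t : ℝ} (ht : 0 ≤ t) :
    x t ∈ B :=
  hx.2.2 t ht

/-- A function continuous on `B` is continuous along a forward trajectory in `B` on `[0, ∞)`.
[folklore] -/
theorem IsForwardTrajectoryIn.continuousOn_comp (hx : IsForwardTrajectoryIn F B x)
    {g : EuclideanSpace ℝ (Fin d) → ℝ} (hg : ContinuousOn g B) :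
    ContinuousOn (fun s => g (x s)) (Ici 0) :=
  hg.comp hx.continuousOn_Ici fun _ hs => hx.mem hs

/-- Interval integrability of a function continuous on `B` along a forward trajectory in `B`.
[folklore] -/
theorem IsForwardTrajectoryIn.intervalIntegrable_comp (hx : IsForwardTrajectoryIn F B x)
    {g : EuclideanSpace ℝ (Fin d) → ℝ} (hg : ContinuousOn g B) {a b : ℝ} (ha : 0 ≤ a)
    (hb : 0 ≤ b) :
    IntervalIntegrable (fun s => g (x s)) volume a b :=
  ((hx.continuousOn_comp hg).mono fun _ hs => le_trans (le_min ha hb) hs.1).intervalIntegrable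

/-- `V ∈ C¹(B)` is differentiable at the points of `B`. [folklore] -/
theorem IsC1Near.hasFDerivAt (hV : IsC1Near B V) {y : EuclideanSpace ℝ (Fin d)} (hy : y ∈ B) :
    HasFDerivAt V (fderiv ℝ V y) y := by
  obtain ⟨U, hUo, hBU, hVU⟩ := hV
  exact (hVU.differentiableOn one_ne_zero).hasFDerivAt (hUo.mem_nhds (hBU hy))

/-- `V ∈ C¹(B)` is continuous on `B`. [folklore] -/
theorem IsC1Near.continuousOn (hV : IsC1Near B V) : ContinuousOn V B := by
  obtain ⟨U, _, hBU, hVU⟩ := hV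
  exact hVU.continuousOn.mono hBU

/-- For `V ∈ C¹(B)`, `x ↦ ∇V(x)` is continuous on `B`. [folklore] -/
theorem IsC1Near.continuousOn_fderiv (hV : IsC1Near B V) :
    ContinuousOn (fun y => fderiv ℝ V y) B := by
  obtain ⟨U, hUo, hBU, hVU⟩ := hV
  exact (hVU.continuousOn_fderiv_of_isOpen hUo le_rfl).mono hBU

/-- The integrand `Φ + F·∇V` of the auxiliary-function bound is continuous on `B`. [folklore] -/
theorem IsC1Near.continuousOn_auxIntegrand (hV : IsC1Near B V) (hF : Continuous F)
    (hΦ : ContinuousOn Φ B) : ContinuousOn (fun y => Φ y + fderiv ℝ V y (F y)) B :=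
  hΦ.add (hV.continuousOn_fderiv.clm_apply hF.continuousOn)

/-- `C¹(B)` is closed under negation. [folklore] -/
theorem IsC1Near.neg (hV : IsC1Near B V) : IsC1Near B (-V) := by
  obtain ⟨U, hUo, hBU, hVU⟩ := hV
  exact ⟨U, hUo, hBU, hVU.neg⟩

/-- `C¹(B)` is closed under addition. [folklore] -/
theorem IsC1Near.add {W : EuclideanSpace ℝ (Fin d) → ℝ} (hV : IsC1Near B V) (hW : IsC1Near B W) :
    IsC1Near B (V + W) := by
  obtain ⟨U, hUo, hBU, hVU⟩ := hV
  obtain ⟨U', hUo', hBU', hWU'⟩ := hW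
  exact ⟨U ∩ U', hUo.inter hUo', subset_inter hBU hBU',
    (hVU.mono inter_subset_left).add (hWU'.mono inter_subset_right)⟩

/-- `C¹(B)` is closed under scalar multiplication. [folklore] -/
theorem IsC1Near.const_smul (hV : IsC1Near B V) (c : ℝ) : IsC1Near B (c • V) := by
  obtain ⟨U, hUo, hBU, hVU⟩ := hV
  exact ⟨U, hUo, hBU, hVU.const_smul c⟩

/-- `0 ∈ C¹(B)`. [folklore] -/
theorem isC1Near_zero : IsC1Near B (0 : EuclideanSpace ℝ (Fin d) → ℝ) :=
  ⟨univ, isOpen_univ, subset_univ _, contDiffOn_const⟩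

/-- A globally `Cⁿ` function, `n ≥ 1`, belongs to `C¹(B)`. [folklore] -/
theorem isC1Near_of_contDiff {ψ : EuclideanSpace ℝ (Fin d) → ℝ} {n : WithTop ℕ∞}
    (hψ : ContDiff ℝ n ψ) (hn : 1 ≤ n) :
    IsC1Near B ψ :=
  ⟨univ, isOpen_univ, subset_univ _, (hψ.of_le hn).contDiffOn⟩

/-- **Weak duality, the key identity (Tobasco–Goluskin–Doering 2018, (4)):** along a forward
trajectory, `∫₀ᵀ F·∇V(x(t)) dt = V(x(T)) − V(x(0))`.
[cite: TobascoGoluskinDoering2018, §2 (4)] -/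
theorem IsForwardTrajectoryIn.integral_fderiv_eq_sub (hx : IsForwardTrajectoryIn F B x)
    (hV : IsC1Near B V) (hF : Continuous F) {T : ℝ} (hT : 0 ≤ T) :
    ∫ t in (0 : ℝ)..T, fderiv ℝ V (x t) (F (x t)) = V (x T) - V (x 0) := by
  have hderiv : ∀ t, 0 ≤ t →
      HasDerivWithinAt (V ∘ x) (fderiv ℝ V (x t) (F (x t))) (Ici 0) t := fun t ht =>
    (hV.hasFDerivAt (hx.mem ht)).comp_hasDerivWithinAt t (hx.2.1 t ht)
  have hcont : ContinuousOn (fun t => fderiv ℝ V (x t) (F (x t))) (Ici 0) :=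
    (hV.continuousOn_fderiv.comp hx.continuousOn_Ici fun _ hs => hx.mem hs).clm_apply
      (hF.comp_continuousOn hx.continuousOn_Ici)
  rw [intervalIntegral.integral_eq_sub_of_hasDeriv_right_of_le hT
    (fun t ht => (hderiv t ht.1).continuousWithinAt.mono fun s hs => hs.1)
    (fun t ht => (hderiv t ht.1.le).mono fun s hs => le_trans ht.1.le (le_of_lt hs))
    ((hcont.mono fun s hs => le_trans (le_min le_rfl hT) hs.1).intervalIntegrable)]
  rfl

/-- The auxiliary-function bound dominates its integrand on `B`. [folklore] -/
theorem le_auxBound (hB : IsCompact B) (hV : IsC1Near B V) (hF : Continuous F)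
    (hΦ : ContinuousOn Φ B) {y : EuclideanSpace ℝ (Fin d)} (hy : y ∈ B) :
    Φ y + fderiv ℝ V y (F y) ≤ auxBound F B Φ V :=
  le_csSup (hB.bddAbove_image (hV.continuousOn_auxIntegrand hF hΦ)) (mem_image_of_mem _ hy)

/-- **Weak duality, finite-time form (Tobasco–Goluskin–Doering 2018, (5)–(6)):**
`∫₀ᵀ Φ(x(t)) dt ≤ T · sup_B (Φ + F·∇V) + (V(x(0)) − V(x(T)))`.
[cite: TobascoGoluskinDoering2018, §2 (5)–(6)] -/
theorem IsForwardTrajectoryIn.integral_le_auxBound (hx : IsForwardTrajectoryIn F B x)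
    (hB : IsCompact B) (hV : IsC1Near B V) (hF : Continuous F) (hΦ : ContinuousOn Φ B)
    {T : ℝ} (hT : 0 ≤ T) :
    ∫ t in (0 : ℝ)..T, Φ (x t) ≤ T * auxBound F B Φ V + (V (x 0) - V (x T)) := by
  have h1 : IntervalIntegrable (fun t => Φ (x t)) volume 0 T :=
    hx.intervalIntegrable_comp hΦ le_rfl hT
  have h2 : IntervalIntegrable (fun t => fderiv ℝ V (x t) (F (x t))) volume 0 T := by
    have := hx.intervalIntegrable_comp
      ((hV.continuousOn_auxIntegrand hF hΦ).sub hΦ) le_rfl hT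
    refine this.congr fun t _ => ?_
    simp
  have h3 : ∫ t in (0 : ℝ)..T, (Φ (x t) + fderiv ℝ V (x t) (F (x t))) ≤
      ∫ _ in (0 : ℝ)..T, auxBound F B Φ V :=
    intervalIntegral.integral_mono_on hT (h1.add h2) intervalIntegrable_const
      fun t ht => le_auxBound hB hV hF hΦ (hx.mem ht.1)
  rw [intervalIntegral.integral_add h1 h2, hx.integral_fderiv_eq_sub hV hF hT,
    intervalIntegral.integral_const, smul_eq_mul, sub_zero] at h3
  linarith

/-- A bound for `|V|` on the compact `B`, for `V ∈ C¹(B)`. [folklore] -/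
theorem IsC1Near.exists_forall_abs_le (hV : IsC1Near B V) (hB : IsCompact B) :
    ∃ N, ∀ y ∈ B, |V y| ≤ N := by
  obtain ⟨N, hN⟩ := hB.exists_bound_of_continuousOn hV.continuousOn
  exact ⟨N, fun y hy => by simpa [Real.norm_eq_abs] using hN y hy⟩

/-- Time averages along a forward trajectory in `B` are bounded by `sup_B |Φ|`. [folklore] -/
theorem IsForwardTrajectoryIn.abs_timeAvg_le (hx : IsForwardTrajectoryIn F B x) {C : ℝ}
    (hC : ∀ y ∈ B, |Φ y| ≤ C) {T : ℝ} (hT : 0 < T) :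
    |T⁻¹ * ∫ t in (0 : ℝ)..T, Φ (x t)| ≤ C := by
  have h := intervalIntegral.norm_integral_le_of_norm_le_const (a := 0) (b := T) (C := C)
    (f := fun t => Φ (x t)) fun t ht => by
      rw [uIoc_of_le hT.le] at ht
      simpa [Real.norm_eq_abs] using hC _ (hx.mem ht.1.le)
  rw [Real.norm_eq_abs, sub_zero, abs_of_pos hT] at h
  rw [abs_mul, abs_inv, abs_of_pos hT]
  calc T⁻¹ * |∫ t in (0 : ℝ)..T, Φ (x t)| ≤ T⁻¹ * (C * T) := by gcongr
    _ = C := by field_simp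

/-- **Weak duality (Tobasco–Goluskin–Doering 2018, (6)):** the long-time average along any
forward trajectory in `B` is at most `sup_B (Φ + F·∇V)` for every `V ∈ C¹(B)`.
[cite: TobascoGoluskinDoering2018, §2 (6)] -/
theorem IsForwardTrajectoryIn.timeAvgLimsup_le_auxBound (hx : IsForwardTrajectoryIn F B x)
    (hB : IsCompact B) (hV : IsC1Near B V) (hF : Continuous F) (hΦ : ContinuousOn Φ B) :
    timeAvgLimsup Φ x ≤ auxBound F B Φ V := by
  obtain ⟨N, hN⟩ := hV.exists_forall_abs_le hB
  obtain ⟨C, hC⟩ := hB.exists_bound_of_continuousOn hΦ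
  have hC' : ∀ y ∈ B, |Φ y| ≤ C := fun y hy => by simpa [Real.norm_eq_abs] using hC y hy
  set S := auxBound F B Φ V
  -- the averages are eventually bounded below, so the `limsup` is not the junk value
  have hcobdd : IsCoboundedUnder (· ≤ ·) atTop fun T : ℝ => T⁻¹ * ∫ t in (0 : ℝ)..T, Φ (x t) :=
    isCoboundedUnder_le_of_eventually_le atTop (x := -C) (by
      filter_upwards [eventually_gt_atTop 0] with T hT
      exact (abs_le.1 (hx.abs_timeAvg_le hC' hT)).1)
  refine le_of_forall_pos_le_add fun ε hε => ?_
  refine limsup_le_of_le hcobdd ?_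
  filter_upwards [eventually_gt_atTop 0, eventually_ge_atTop (2 * N / ε)] with T hT hTN
  have h1 := hx.integral_le_auxBound hB hV hF hΦ hT.le
  have h2 : V (x 0) - V (x T) ≤ 2 * N := by
    have := hN _ (hx.mem le_rfl); have := hN _ (hx.mem hT.le)
    linarith [abs_le.1 ‹|V (x 0)| ≤ N›, abs_le.1 ‹|V (x T)| ≤ N›]
  have hN0 : 0 ≤ N := (abs_nonneg _).trans (hN _ (hx.mem le_rfl))
  have h3 : 2 * N ≤ ε * T := by
    rw [div_le_iff₀ hε] at hTN; linarith
  calc T⁻¹ * ∫ t in (0 : ℝ)..T, Φ (x t) ≤ T⁻¹ * (T * S + ε * T) :=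
        mul_le_mul_of_nonneg_left (by linarith) (inv_nonneg.2 hT.le)
    _ = S + ε := by field_simp

end WeakDuality

section Flow

variable {F : EuclideanSpace ℝ (Fin d) → EuclideanSpace ℝ (Fin d)}
  {B : Set (EuclideanSpace ℝ (Fin d))} {x y : ℝ → EuclideanSpace ℝ (Fin d)} {K : ℝ≥0}

/-- A `C¹` map is Lipschitz on every compact set. [folklore] -/
theorem exists_lipschitzOnWith_of_contDiff {G : Type*} [NormedAddCommGroup G] [NormedSpace ℝ G]
    {f : EuclideanSpace ℝ (Fin d) → G} (hf : ContDiff ℝ 1 f) (hB : IsCompact B) :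
    ∃ K : ℝ≥0, LipschitzOnWith K f B := by
  obtain ⟨R, hR⟩ := (hB.isBounded.subset_closedBall (0 : EuclideanSpace ℝ (Fin d)))
  obtain ⟨C, hC⟩ :=
    (isCompact_closedBall (0 : EuclideanSpace ℝ (Fin d)) R).exists_bound_of_continuousOn
      (hf.continuous_fderiv one_ne_zero).continuousOn
  refine ⟨C.toNNReal, LipschitzOnWith.mono ?_ hR⟩
  refine (convex_closedBall (0 : EuclideanSpace ℝ (Fin d)) R).lipschitzOnWith_of_nnnorm_fderiv_le
    (fun z _ => hf.contDiffAt.differentiableAt one_ne_zero) fun z hz => ?_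
  rw [← NNReal.coe_le_coe, coe_nnnorm, Real.coe_toNNReal']
  exact (hC z hz).trans (le_max_left _ _)

/-- A continuous vector field is bounded on a compact set. [folklore] -/
theorem exists_forall_norm_le_of_isCompact (hF : Continuous F) (hB : IsCompact B) :
    ∃ M : ℝ, 0 ≤ M ∧ ∀ y ∈ B, ‖F y‖ ≤ M := by
  obtain ⟨M, hM⟩ := hB.exists_bound_of_continuousOn hF.continuousOn
  exact ⟨max M 0, le_max_right _ _, fun y hy => (hM y hy).trans (le_max_left _ _)⟩

/-- **Uniqueness of forward trajectories in `B`** (Grönwall): two forward trajectories in `B`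
with the same initial point coincide on `[0, ∞)`. [folklore] -/
theorem IsForwardTrajectoryIn.eqOn_Ici (hK : LipschitzOnWith K F B)
    (hx : IsForwardTrajectoryIn F B x) (hy : IsForwardTrajectoryIn F B y) (h0 : x 0 = y 0) :
    EqOn x y (Ici 0) := by
  intro T hT
  have := ODE_solution_unique_of_mem_Icc_right (v := fun _ => F) (s := fun _ => B) (K := K)
    (f := x) (g := y) (a := 0) (b := T) (fun _ _ => hK)
    (hx.continuousOn_Ici.mono Icc_subset_Ici_self) (fun t ht => hx.hasDerivWithinAt_Ici ht.1)
    (fun t ht => hx.mem ht.1)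
    (hy.continuousOn_Ici.mono Icc_subset_Ici_self) (fun t ht => hy.hasDerivWithinAt_Ici ht.1)
    (fun t ht => hy.mem ht.1) h0
  exact this ⟨hT, le_rfl⟩

/-- The time-shift of a forward trajectory in `B` is a forward trajectory in `B`. [folklore] -/
theorem IsForwardTrajectoryIn.shift (hx : IsForwardTrajectoryIn F B x) {s : ℝ} (hs : 0 ≤ s) :
    IsForwardTrajectoryIn F B fun t => x (t + s) := by
  refine ⟨by simpa using hx.mem hs, fun t ht => ?_, fun t ht => hx.mem (add_nonneg ht hs)⟩
  rcases (add_nonneg ht hs).eq_or_lt with h0 | hpos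
  · have hs0 : s = 0 := le_antisymm (by linarith) hs
    have ht0 : t = 0 := le_antisymm (by linarith) ht
    subst hs0; subst ht0
    simpa using hx.2.1 0 le_rfl
  · have h1 : HasDerivAt x (F (x (t + s))) (t + s) :=
      (hx.2.1 (t + s) hpos.le).hasDerivAt (Ici_mem_nhds hpos)
    exact (h1.comp_add_const t s).hasDerivWithinAt

/-- **Lipschitz dependence on the initial point** (Grönwall):
`dist (x t) (y t) ≤ dist (x 0) (y 0) · e^{Kt}` for forward trajectories in `B`. [folklore] -/
theorem IsForwardTrajectoryIn.dist_le (hK : LipschitzOnWith K F B)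
    (hx : IsForwardTrajectoryIn F B x) (hy : IsForwardTrajectoryIn F B y) {t : ℝ} (ht : 0 ≤ t) :
    dist (x t) (y t) ≤ dist (x 0) (y 0) * Real.exp (K * t) := by
  have := dist_le_of_trajectories_ODE_of_mem (v := fun _ => F) (s := fun _ => B) (K := K)
    (f := x) (g := y) (a := 0) (b := t) (δ := dist (x 0) (y 0)) (fun _ _ => hK)
    (hx.continuousOn_Ici.mono Icc_subset_Ici_self) (fun t ht => hx.hasDerivWithinAt_Ici ht.1)
    (fun t ht => hx.mem ht.1)
    (hy.continuousOn_Ici.mono Icc_subset_Ici_self) (fun t ht => hy.hasDerivWithinAt_Ici ht.1)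
    (fun t ht => hy.mem ht.1) le_rfl t ⟨ht, le_rfl⟩
  simpa using this

/-- **Speed bound:** `‖x(t) − x(0)‖ ≤ M t` when `‖F‖ ≤ M` on `B`. [folklore] -/
theorem IsForwardTrajectoryIn.norm_sub_le (hx : IsForwardTrajectoryIn F B x) {M : ℝ}
    (hM : ∀ y ∈ B, ‖F y‖ ≤ M) {t : ℝ} (ht : 0 ≤ t) : ‖x t - x 0‖ ≤ M * t := by
  have := norm_image_sub_le_of_norm_deriv_right_le_segment (f := x) (a := 0) (b := t)
    (f' := fun s => F (x s)) (C := M)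
    (hx.continuousOn_Ici.mono Icc_subset_Ici_self) (fun s hs => hx.hasDerivWithinAt_Ici hs.1)
    (fun s hs => hM _ (hx.mem hs.1)) t ⟨ht, le_rfl⟩
  simpa using this

/-- **Second-order speed bound:** `‖x(t) − x(0) − t F(x(0))‖ ≤ K M t²` when `F` is `K`-Lipschitz
and bounded by `M` on `B`. [folklore] -/
theorem IsForwardTrajectoryIn.norm_sub_sub_le (hx : IsForwardTrajectoryIn F B x)
    (hK : LipschitzOnWith K F B) {M : ℝ} (hM0 : 0 ≤ M) (hM : ∀ y ∈ B, ‖F y‖ ≤ M) {t : ℝ}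
    (ht : 0 ≤ t) : ‖x t - x 0 - t • F (x 0)‖ ≤ K * M * t * t := by
  have hderiv : ∀ s ∈ Ico 0 t, HasDerivWithinAt (fun s => x s - x 0 - s • F (x 0))
      (F (x s) - F (x 0)) (Ici s) s := by
    intro s hs
    have h1 := hx.hasDerivWithinAt_Ici hs.1
    have h2 : HasDerivWithinAt (fun s : ℝ => s • F (x 0)) ((1 : ℝ) • F (x 0)) (Ici s) s :=
      (hasDerivWithinAt_id s _).smul_const _
    have h3 : HasDerivWithinAt (fun s => x s - x 0 - s • F (x 0))
        (F (x s) - (1 : ℝ) • F (x 0)) (Ici s) s := (h1.sub_const (x 0)).sub h2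
    simpa using h3
  have hcont : ContinuousOn (fun s => x s - x 0 - s • F (x 0)) (Icc 0 t) :=
    ((hx.continuousOn_Ici.mono Icc_subset_Ici_self).sub continuousOn_const).sub
      (continuousOn_id.smul continuousOn_const)
  have := norm_image_sub_le_of_norm_deriv_right_le_segment hcont hderiv (C := K * M * t)
    (fun s hs => ?_) t ⟨ht, le_rfl⟩
  · simpa using this
  · calc ‖F (x s) - F (x 0)‖ ≤ K * ‖x s - x 0‖ := by
          rw [← dist_eq_norm, ← dist_eq_norm]
          exact hK.dist_le_mul _ (hx.mem hs.1) _ (hx.mem le_rfl)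
      _ ≤ K * (M * s) := by gcongr; exact hx.norm_sub_le hM hs.1
      _ = K * M * s := by ring
      _ ≤ K * M * t := mul_le_mul_of_nonneg_left hs.2.le (mul_nonneg K.2 hM0)

variable {φ : EuclideanSpace ℝ (Fin d) → ℝ → EuclideanSpace ℝ (Fin d)}

/-- **Semigroup identity** `φ_t (φ_s b) = φ_{t+s} b` for the flow on `B`. [folklore] -/
theorem flow_flow (hK : LipschitzOnWith K F B)
    (hφ : ∀ b ∈ B, φ b 0 = b ∧ IsForwardTrajectoryIn F B (φ b)) {b : EuclideanSpace ℝ (Fin d)}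
    (hb : b ∈ B)
    {s t : ℝ} (hs : 0 ≤ s) (ht : 0 ≤ t) : φ (φ b s) t = φ b (t + s) := by
  have hbs : φ b s ∈ B := (hφ b hb).2.mem hs
  have h1 : IsForwardTrajectoryIn F B (φ (φ b s)) := (hφ _ hbs).2
  have h2 : IsForwardTrajectoryIn F B fun u => φ b (u + s) := (hφ b hb).2.shift hs
  exact h1.eqOn_Ici hK h2 (by simpa using (hφ _ hbs).1) ht

/-- Continuity on `B` of `b ↦ ∫ₐᵇ g(φ_s b) ds` for `g` continuous on `B`. [folklore] -/
theorem continuousOn_integral_flow (hB : IsCompact B) (hK : LipschitzOnWith K F B)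
    (hφ : ∀ b ∈ B, φ b 0 = b ∧ IsForwardTrajectoryIn F B (φ b)) {g : EuclideanSpace ℝ (Fin d) → ℝ}
    (hg : ContinuousOn g B) {a T : ℝ} (ha : 0 ≤ a) (hT : 0 ≤ T) :
    ContinuousOn (fun b => ∫ s in a..T, g (φ b s)) B := by
  rw [Metric.continuousOn_iff]
  intro b hb ε hε
  obtain ⟨δ₁, hδ₁, hg'⟩ := Metric.uniformContinuousOn_iff.1
    (hB.uniformContinuousOn_of_continuous hg) (ε / (|T - a| + 1)) (by positivity)
  refine ⟨δ₁ / Real.exp (K * max a T), by positivity, fun b' hb' hbb' => ?_⟩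
  have hI : ∀ c ∈ B, IntervalIntegrable (fun s => g (φ c s)) volume a T := fun c hc =>
    (hφ c hc).2.intervalIntegrable_comp hg ha hT
  rw [Real.dist_eq, ← intervalIntegral.integral_sub (hI b' hb') (hI b hb)]
  have hbound : ∀ s ∈ Ι a T, ‖g (φ b' s) - g (φ b s)‖ ≤ ε / (|T - a| + 1) := by
    intro s hs
    have hs0 : 0 ≤ s := (lt_of_le_of_lt (le_min ha hT) hs.1).le
    have hsm : s ≤ max a T := hs.2
    refine le_of_lt (hg' _ ((hφ b' hb').2.mem hs0) _ ((hφ b hb).2.mem hs0) ?_)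
    calc dist (φ b' s) (φ b s) ≤ dist (φ b' 0) (φ b 0) * Real.exp (K * s) :=
          (hφ b' hb').2.dist_le hK (hφ b hb).2 hs0
      _ ≤ dist b' b * Real.exp (K * max a T) := by
          rw [(hφ b' hb').1, (hφ b hb).1]; gcongr
      _ < δ₁ := by rwa [lt_div_iff₀ (Real.exp_pos _)] at hbb'
  calc |∫ s in a..T, g (φ b' s) - g (φ b s)|
      ≤ ε / (|T - a| + 1) * |T - a| := intervalIntegral.norm_integral_le_of_norm_le_const hbound
    _ < ε := by
        rw [div_mul_eq_mul_div, div_lt_iff₀ (by positivity)]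
        nlinarith [abs_nonneg (T - a)]

end Flow

section StrongDuality

/-! ### H — strong duality through Hahn–Banach and Riesz–Markov–Kakutani -/

variable {F : EuclideanSpace ℝ (Fin d) → EuclideanSpace ℝ (Fin d)}
  {B : Set (EuclideanSpace ℝ (Fin d))} {Φ : EuclideanSpace ℝ (Fin d) → ℝ}
  {V : EuclideanSpace ℝ (Fin d) → ℝ} {x : ℝ → EuclideanSpace ℝ (Fin d)}

/-- A lower bound of `Φ` on `B` is below the long-time average along a trajectory in `B`.
[folklore] -/
theorem IsForwardTrajectoryIn.le_timeAvgLimsup (hx : IsForwardTrajectoryIn F B x)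
    (hB : IsCompact B) (hΦ : ContinuousOn Φ B) {lo : ℝ} (hlo : ∀ y ∈ B, lo ≤ Φ y) :
    lo ≤ timeAvgLimsup Φ x := by
  obtain ⟨C, hC⟩ := hB.exists_bound_of_continuousOn hΦ
  have hC' : ∀ y ∈ B, |Φ y| ≤ C := fun y hy => by simpa [Real.norm_eq_abs] using hC y hy
  have hbdd : IsBoundedUnder (· ≤ ·) atTop fun T : ℝ => T⁻¹ * ∫ t in (0 : ℝ)..T, Φ (x t) :=
    ⟨C, by
      rw [eventually_map]
      filter_upwards [eventually_gt_atTop 0] with T hT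
      exact (abs_le.1 (hx.abs_timeAvg_le hC' hT)).2⟩
  refine le_limsup_of_frequently_le (Eventually.frequently ?_) hbdd
  filter_upwards [eventually_gt_atTop 0] with T hT
  rw [le_inv_mul_iff₀ hT]
  have h := intervalIntegral.integral_mono_on hT.le intervalIntegrable_const
    (hx.intervalIntegrable_comp hΦ le_rfl hT.le) fun t ht => hlo _ (hx.mem ht.1)
  simpa [mul_comm] using h

/-- **Strong duality, functional form (Tobasco–Goluskin–Doering 2018, (10b)–(10d); here by
Hahn–Banach instead of Sion's minimax theorem).** There is a positive normalised linear
functional `ℓ` on `C(B)` annihilating every `F·∇ψ`, `ψ ∈ C¹(B)`, with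
`ℓ(Φ|_B) = inf_{V ∈ C¹(B)} sup_B (Φ + F·∇V)`.
[cite: TobascoGoluskinDoering2018, §5 (10b)–(10d), (13)] -/
theorem exists_dualFunctional (hF : ContDiff ℝ 1 F) (hB : IsCompact B) (hne : B.Nonempty)
    (htraj : ∀ x₀ ∈ B, ∃ x : ℝ → EuclideanSpace ℝ (Fin d), x 0 = x₀ ∧ IsForwardTrajectoryIn F B x)
    (Φ : EuclideanSpace ℝ (Fin d) → ℝ) (hΦ : Continuous Φ) :
    ∃ ℓ : C(B, ℝ) →ₗ[ℝ] ℝ,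
      (∀ h h' : C(B, ℝ), (∀ b, h b ≤ h' b) → ℓ h ≤ ℓ h') ∧
      (∀ h : C(B, ℝ), (∀ b, h b = 1) → ℓ h = 1) ∧
      (∀ (ψ : EuclideanSpace ℝ (Fin d) → ℝ) (h : C(B, ℝ)), IsC1Near B ψ →
        (∀ b : B, h b = fderiv ℝ ψ b (F b)) → ℓ h = 0) ∧
      ∀ h : C(B, ℝ), (∀ b : B, h b = Φ b) →
        ℓ h = sInf {r | ∃ V, IsC1Near B V ∧ auxBound F B Φ V = r} := by
  classical
  haveI : CompactSpace B := isCompact_iff_compactSpace.mp hB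
  haveI : Nonempty B := hne.to_subtype
  have hFc : Continuous F := hF.continuous
  -- the bounds `S h V = sup_B (h + F·∇V)` and the value `N h = inf_V S h V`
  set S : C(B, ℝ) → (EuclideanSpace ℝ (Fin d) → ℝ) → ℝ := fun h V =>
    sSup (Set.range fun b : B => h b + fderiv ℝ V b (F b)) with hS
  set N : C(B, ℝ) → ℝ := fun h => sInf {r | ∃ V, IsC1Near B V ∧ S h V = r} with hN
  have hcontL : ∀ V, IsC1Near B V → Continuous fun b : B => fderiv ℝ V b (F b) := fun V hV =>
    (hV.continuousOn_fderiv.clm_apply hFc.continuousOn).comp_continuous continuous_subtype_val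
      fun b => b.2
  have hbdd : ∀ (h : C(B, ℝ)) (V : EuclideanSpace ℝ (Fin d) → ℝ), IsC1Near B V →
      BddAbove (Set.range fun b : B => h b + fderiv ℝ V b (F b)) := fun h V hV =>
    (isCompact_range (h.continuous.add (hcontL V hV))).bddAbove
  have hleS : ∀ (h : C(B, ℝ)) (V : EuclideanSpace ℝ (Fin d) → ℝ), IsC1Near B V → ∀ b : B,
      h b + fderiv ℝ V b (F b) ≤ S h V :=
    fun h V hV b => le_csSup (hbdd h V hV) ⟨b, rfl⟩
  have hSle : ∀ (h : C(B, ℝ)) (V : EuclideanSpace ℝ (Fin d) → ℝ) (r : ℝ),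
      (∀ b : B, h b + fderiv ℝ V b (F b) ≤ r) → S h V ≤ r :=
    fun h V r H => csSup_le (range_nonempty _) (by rintro _ ⟨b, rfl⟩; exact H b)
  -- derivative algebra on `B`
  have hfd_smul : ∀ (V : EuclideanSpace ℝ (Fin d) → ℝ) (c : ℝ), IsC1Near B V → ∀ b : B,
      fderiv ℝ (c • V) b = c • fderiv ℝ V b := fun V c hV b =>
    ((hV.hasFDerivAt b.2).const_smul c).fderiv
  have hfd_add : ∀ (V W : EuclideanSpace ℝ (Fin d) → ℝ), IsC1Near B V → IsC1Near B W → ∀ b : B,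
      fderiv ℝ (V + W) b = fderiv ℝ V b + fderiv ℝ W b := fun V W hV hW b =>
    ((hV.hasFDerivAt b.2).add (hW.hasFDerivAt b.2)).fderiv
  have hfd_neg : ∀ (V : EuclideanSpace ℝ (Fin d) → ℝ), IsC1Near B V → ∀ b : B,
      fderiv ℝ (-V) b = -fderiv ℝ V b := fun V hV b =>
    (hV.hasFDerivAt b.2).neg.fderiv
  have hfd_zero : ∀ b : EuclideanSpace ℝ (Fin d),
      fderiv ℝ (0 : EuclideanSpace ℝ (Fin d) → ℝ) b = 0 := fun b => by
    rw [fderiv_zero]; rfl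
  -- `S h 0 = sup h`-type bounds
  have hS0 : ∀ (h : C(B, ℝ)) (r : ℝ), (∀ b : B, h b ≤ r) → S h 0 ≤ r := fun h r H =>
    hSle h 0 r fun b => by rw [hfd_zero]; simpa using H b
  -- lower bound: `S h V ≥ -‖h‖` by weak duality along a trajectory
  have hlo : ∀ h : C(B, ℝ), ∃ lo : ℝ, ∀ V : EuclideanSpace ℝ (Fin d) → ℝ,
      IsC1Near B V → lo ≤ S h V := by
    intro h
    obtain ⟨g, hg⟩ := ContinuousMap.exists_restrict_eq hB.isClosed h
    have hgb : ∀ b : B, g b = h b := fun b => by rw [← hg]; rfl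
    obtain ⟨C, hC⟩ := hB.exists_bound_of_continuousOn g.continuous.continuousOn
    obtain ⟨b₀, hb₀⟩ := hne
    obtain ⟨x, -, hx⟩ := htraj b₀ hb₀
    refine ⟨-C, fun V hV => ?_⟩
    have hSeq : S h V = auxBound F B g V := by
      have hfun : (fun b : B => h b + fderiv ℝ V b (F b)) =
          fun b : B => g b + fderiv ℝ V b (F b) := by
        funext b; rw [hgb]
      simp only [hS, auxBound, image_eq_range, hfun]
    rw [hSeq]
    refine le_trans ?_ (hx.timeAvgLimsup_le_auxBound hB hV hFc g.continuous.continuousOn)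
    refine hx.le_timeAvgLimsup hB g.continuous.continuousOn fun y hy => ?_
    have := hC y hy
    rw [Real.norm_eq_abs] at this
    linarith [abs_le.1 this]
  have hne_set : ∀ h : C(B, ℝ), ({r | ∃ V, IsC1Near B V ∧ S h V = r} : Set ℝ).Nonempty :=
    fun h => ⟨_, 0, isC1Near_zero, rfl⟩
  have hbddB : ∀ h : C(B, ℝ), BddBelow ({r | ∃ V, IsC1Near B V ∧ S h V = r} : Set ℝ) := by
    intro h
    obtain ⟨lo, hlo⟩ := hlo h
    exact ⟨lo, by rintro _ ⟨V, hV, rfl⟩; exact hlo V hV⟩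
  have hN_le : ∀ (h : C(B, ℝ)) (V : EuclideanSpace ℝ (Fin d) → ℝ), IsC1Near B V → N h ≤ S h V :=
      fun h V hV =>
    csInf_le (hbddB h) ⟨V, hV, rfl⟩
  have hle_N : ∀ (h : C(B, ℝ)) (r : ℝ),
      (∀ V : EuclideanSpace ℝ (Fin d) → ℝ, IsC1Near B V → r ≤ S h V) →
      r ≤ N h :=
    fun h r H => le_csInf (hne_set h) (by rintro _ ⟨V, hV, rfl⟩; exact H V hV)
  -- positive homogeneity of `N`
  have hSsmul : ∀ (c : ℝ) (h : C(B, ℝ)) (V : EuclideanSpace ℝ (Fin d) → ℝ), 0 < c → IsC1Near B V →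
      S (c • h) (c • V) = c * S h V := by
    intro c h V hc hV
    have : (fun b : B => (c • h) b + fderiv ℝ (c • V) b (F b)) =
        fun b : B => c • (h b + fderiv ℝ V b (F b)) := by
      funext b
      rw [hfd_smul V c hV b]
      simp [mul_add]
    simp only [hS]
    rw [this, range_smul, Real.sSup_smul_of_nonneg hc.le, smul_eq_mul]
  have hNhom : ∀ c : ℝ, 0 < c → ∀ h : C(B, ℝ), N (c • h) = c * N h := by
    intro c hc h
    have hset : ({r | ∃ V, IsC1Near B V ∧ S (c • h) V = r} : Set ℝ) =
        c • {r | ∃ V, IsC1Near B V ∧ S h V = r} := by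
      ext r
      simp only [mem_setOf_eq, mem_smul_set, smul_eq_mul]
      constructor
      · rintro ⟨V, hV, rfl⟩
        refine ⟨S h (c⁻¹ • V), ⟨c⁻¹ • V, hV.const_smul _, rfl⟩, ?_⟩
        rw [← hSsmul c h _ hc (hV.const_smul _), smul_inv_smul₀ hc.ne']
      · rintro ⟨_, ⟨V, hV, rfl⟩, rfl⟩
        exact ⟨c • V, hV.const_smul _, hSsmul c h V hc hV⟩
    simp only [hN]
    rw [hset, Real.sInf_smul_of_nonneg hc.le, smul_eq_mul]
  -- subadditivity of `N`
  have hNadd : ∀ h h' : C(B, ℝ), N (h + h') ≤ N h + N h' := by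
    intro h h'
    have key : ∀ V V' : EuclideanSpace ℝ (Fin d) → ℝ, IsC1Near B V → IsC1Near B V' →
        N (h + h') ≤ S h V + S h' V' := by
      intro V V' hV hV'
      refine (hN_le _ _ (hV.add hV')).trans (hSle _ _ _ fun b => ?_)
      rw [hfd_add V V' hV hV' b]
      simp only [ContinuousMap.add_apply, FunLike.coe_add, Pi.add_apply]
      linarith [hleS h V hV b, hleS h' V' hV' b]
    have k2 : ∀ V' : EuclideanSpace ℝ (Fin d) → ℝ, IsC1Near B V' → N (h + h') - S h' V' ≤ N h :=
        fun V' hV' =>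
      hle_N _ _ fun V hV => by linarith [key V V' hV hV']
    have k3 : N (h + h') - N h ≤ N h' := hle_N _ _ fun V' hV' => by linarith [k2 V' hV']
    linarith
  have hN0 : N 0 = 0 := by
    have := hNhom 2 two_pos 0
    rw [smul_zero] at this
    linarith
  -- Hahn–Banach: extend `c • Φ|_B ↦ c • N (Φ|_B)` dominated by `N`
  set ΦB : C(B, ℝ) := ⟨fun b => Φ b, hΦ.comp continuous_subtype_val⟩ with hΦB
  have H0 : ∀ c : ℝ, c • ΦB = 0 → (RingHom.id ℝ) c • N ΦB = 0 := by
    intro c hc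
    rcases eq_or_ne c 0 with rfl | hc0
    · simp
    · have : ΦB = 0 := by simpa [hc0] using hc
      rw [this, hN0, smul_zero]
  set f₀ := LinearPMap.mkSpanSingleton' (σ := RingHom.id ℝ) ΦB (N ΦB) H0 with hf₀
  have hNneg : ∀ h : C(B, ℝ), -N h ≤ N (-h) := fun h => by
    have := hNadd h (-h)
    rw [add_neg_cancel, hN0] at this
    linarith
  have hdom : ∀ c : ℝ, c * N ΦB ≤ N (c • ΦB) := by
    intro c
    rcases lt_trichotomy c 0 with hc | rfl | hc
    · have h1 : N (c • ΦB) = (-c) * N (-ΦB) := by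
        rw [← hNhom (-c) (by linarith) (-ΦB), smul_neg, neg_smul, neg_neg]
      rw [h1]
      nlinarith [hNneg ΦB]
    · simp [hN0]
    · rw [hNhom c hc]
  have hf₀N : ∀ z : f₀.domain, f₀ z ≤ N z := by
    rintro ⟨z, hz⟩
    obtain ⟨c, rfl⟩ := Submodule.mem_span_singleton.1 hz
    rw [LinearPMap.mkSpanSingleton'_apply]
    simpa using hdom c
  obtain ⟨ℓ, hℓf, hℓN⟩ := exists_extension_of_le_sublinear f₀ N hNhom hNadd hf₀N
  -- the extension is positive, normalised, kills `F·∇ψ`, and takes the value `N ΦB` at `ΦB`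
  have hℓ_nonpos : ∀ h : C(B, ℝ), (∀ b, h b ≤ 0) → ℓ h ≤ 0 := fun h H =>
    (hℓN h).trans ((hN_le h 0 isC1Near_zero).trans (hS0 h 0 fun b => H b))
  refine ⟨ℓ, fun h h' H => ?_, fun h H => ?_, fun ψ h hψ H => ?_, fun h H => ?_⟩
  · have := hℓ_nonpos (h - h') fun b => by simp only [ContinuousMap.sub_apply]; linarith [H b]
    rwa [map_sub, sub_nonpos] at this
  · apply le_antisymm
    · exact (hℓN h).trans ((hN_le h 0 isC1Near_zero).trans (hS0 h 1 fun b => (H b).le))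
    · have h1 : ℓ (-h) ≤ -1 :=
        (hℓN _).trans ((hN_le _ 0 isC1Near_zero).trans (hS0 _ _ fun b => by simp [H b]))
      rw [map_neg] at h1
      linarith
  · apply le_antisymm
    · refine (hℓN h).trans ((hN_le h (-ψ) hψ.neg).trans (hSle _ _ _ fun b => ?_))
      rw [hfd_neg ψ hψ b, H b]
      simp
    · have h1 : ℓ (-h) ≤ 0 := by
        refine (hℓN _).trans ((hN_le _ ψ hψ).trans (hSle _ _ _ fun b => ?_))
        simp [H b]
      rw [map_neg] at h1
      linarith
  · have hh : h = ΦB := by ext b; exact H b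
    subst hh
    have h1 : ℓ ΦB = N ΦB := by
      have := hℓf ⟨ΦB, Submodule.mem_span_singleton_self ΦB⟩
      rw [this]
      exact LinearPMap.mkSpanSingleton'_apply_self _ _ _ _
    rw [h1]
    simp only [hN, hS, auxBound, image_eq_range]
    rfl

open scoped CompactlySupported in
/-- **Strong duality, measure form (Tobasco–Goluskin–Doering 2018, (10b)–(10d) with the
Eulerian stationarity (11)).** There is a Borel probability measure `μ` carried by `B`,
stationary in the Eulerian sense `∫ F·∇ψ dμ = 0` for every `ψ ∈ C¹(B)`, whose `Φ`-average is
exactly `inf_{V ∈ C¹(B)} sup_B (Φ + F·∇V)` (Hahn–Banach + Riesz–Markov–Kakutani).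
[cite: TobascoGoluskinDoering2018, §5 (10b)–(10d), (11)] -/
theorem exists_stationaryMeasure (hF : ContDiff ℝ 1 F) (hB : IsCompact B) (hne : B.Nonempty)
    (htraj : ∀ x₀ ∈ B, ∃ x : ℝ → EuclideanSpace ℝ (Fin d), x 0 = x₀ ∧ IsForwardTrajectoryIn F B x)
    (hΦ : Continuous Φ) :
    ∃ μ : Measure (EuclideanSpace ℝ (Fin d)), IsProbabilityMeasure μ ∧ μ Bᶜ = 0 ∧
      (∀ ψ : EuclideanSpace ℝ (Fin d) → ℝ, IsC1Near B ψ → ∫ y, fderiv ℝ ψ y (F y) ∂μ = 0) ∧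
      ∫ y, Φ y ∂μ = sInf {r | ∃ V, IsC1Near B V ∧ auxBound F B Φ V = r} := by
  classical
  haveI : CompactSpace B := isCompact_iff_compactSpace.mp hB
  obtain ⟨ℓ, hmono, hone, hkill, hval⟩ := exists_dualFunctional hF hB hne htraj Φ hΦ
  have hFc : Continuous F := hF.continuous
  -- the positive linear functional on `C_c(B, ℝ) = C(B, ℝ)` and its Riesz measure
  let Λ : C_c(B, ℝ) →ₚ[ℝ] ℝ :=
    { toFun := fun f => ℓ f.toContinuousMap
      map_add' := fun f g => by rw [← map_add]; rfl
      map_smul' := fun c f => by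
        show ℓ (c • f).toContinuousMap = c • ℓ f.toContinuousMap
        rw [← map_smul]; rfl
      monotone' := fun f g hfg => hmono _ _ fun b =>
        CompactlySupportedContinuousMap.le_def.1 hfg b }
  set μB : Measure B := RealRMK.rieszMeasure Λ with hμB
  have hint : ∀ g : C(B, ℝ), ∫ b, g b ∂μB = ℓ g := fun g =>
    RealRMK.integral_rieszMeasure Λ ⟨g, HasCompactSupport.of_compactSpace g⟩
  have huniv : μB univ = 1 := by
    have h1 : ∫ b, (1 : C(B, ℝ)) b ∂μB = 1 := by rw [hint]; exact hone 1 fun b => rfl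
    simp only [ContinuousMap.one_apply, integral_const, smul_eq_mul, mul_one,
      measureReal_def] at h1
    exact (ENNReal.toReal_eq_one_iff _).1 h1
  haveI : IsProbabilityMeasure μB := ⟨huniv⟩
  have hBm : MeasurableSet B := hB.isClosed.measurableSet
  have hemb : MeasurableEmbedding (Subtype.val : B → EuclideanSpace ℝ (Fin d)) :=
    MeasurableEmbedding.subtype_coe hBm
  refine ⟨μB.map Subtype.val, Measure.isProbabilityMeasure_map hemb.measurable.aemeasurable,
    ?_, ?_, ?_⟩
  · rw [Measure.map_apply hemb.measurable hBm.compl]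
    have : (Subtype.val : B → EuclideanSpace ℝ (Fin d)) ⁻¹' Bᶜ = ∅ := by
      ext b
      simp
    rw [this, measure_empty]
  · intro ψ hψ
    rw [hemb.integral_map]
    have hc : Continuous fun b : B => fderiv ℝ ψ b (F b) :=
      (hψ.continuousOn_fderiv.clm_apply hFc.continuousOn).comp_continuous
        continuous_subtype_val fun b => b.2
    have := hint ⟨fun b : B => fderiv ℝ ψ b (F b), hc⟩
    rw [hkill ψ _ hψ fun b => rfl] at this
    exact this
  · rw [hemb.integral_map]
    have := hint ⟨fun b : B => Φ b, hΦ.comp continuous_subtype_val⟩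
    rw [hval _ fun b => rfl] at this
    exact this

end StrongDuality

section EulerianToLagrangian

/-! ### K — Eulerian stationarity controls time averages along the flow -/

variable {F : EuclideanSpace ℝ (Fin d) → EuclideanSpace ℝ (Fin d)}
  {B : Set (EuclideanSpace ℝ (Fin d))} {K : ℝ≥0}
  {φ : EuclideanSpace ℝ (Fin d) → ℝ → EuclideanSpace ℝ (Fin d)}

/-- A measure with `ν Bᶜ = 0` is carried by `B`. This is Mathlib's `Filter.eventually_mem_set`
(with `MeasureTheory.mem_ae_iff`, both `Iff.rfl`); kept only as a deprecated alias — use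
`eventually_mem_set.mpr hνB` directly. [folklore] -/
@[deprecated Filter.eventually_mem_set (since := "2026-08-16")]
theorem ae_mem_of_measure_compl_eq_zero {ν : Measure (EuclideanSpace ℝ (Fin d))} (hνB : ν Bᶜ = 0) :
    ∀ᵐ y ∂ν, y ∈ B :=
  eventually_mem_set.mpr hνB

/-- Integrability against a finite measure carried by the compact `B` of a function continuous
on `B`. [folklore] -/
theorem integrable_of_continuousOn_of_null (hB : IsCompact B)
    {ν : Measure (EuclideanSpace ℝ (Fin d))} [IsFiniteMeasure ν] (hνB : ν Bᶜ = 0)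
    {h : EuclideanSpace ℝ (Fin d) → ℝ} (hh : ContinuousOn h B) :
    Integrable h ν := by
  have hae : ∀ᵐ y ∂ν, y ∈ B := eventually_mem_set.mpr hνB
  have hres : ν.restrict B = ν := Measure.restrict_eq_self_of_ae_mem hae
  obtain ⟨C, hC⟩ := hB.exists_bound_of_continuousOn hh
  have hmeas : AEStronglyMeasurable h ν := by
    rw [← hres]; exact hh.aestronglyMeasurable hB.isClosed.measurableSet
  exact Integrable.of_bound hmeas C (hae.mono fun y hy => hC y hy)

/-- **McShane extension with attained infimum.** For `V` continuous on the nonempty compact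
`B` and `K' ≥ 0`, `w ↦ min_{b ∈ B} (V b + K' dist w b)` is `K'`-Lipschitz, lies below every
`V b + K' dist w b`, and the minimum is attained. [folklore] -/
theorem exists_mcShane (hB : IsCompact B) (hne : B.Nonempty) {V : EuclideanSpace ℝ (Fin d) → ℝ}
    (hV : ContinuousOn V B) (K' : ℝ≥0) :
    ∃ W : EuclideanSpace ℝ (Fin d) → ℝ, LipschitzWith K' W ∧
      (∀ w, ∀ b ∈ B, W w ≤ V b + K' * dist w b) ∧
      ∀ w, ∃ b ∈ B, W w = V b + K' * dist w b := by
  haveI : Nonempty B := hne.to_subtype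
  have hcont : ∀ w : EuclideanSpace ℝ (Fin d), ContinuousOn (fun b => V b + K' * dist w b) B :=
      fun w =>
    hV.add (continuousOn_const.mul (continuous_const.dist continuous_id).continuousOn)
  obtain ⟨C, hC⟩ := hB.exists_bound_of_continuousOn hV
  have hbdd : ∀ w : EuclideanSpace ℝ (Fin d),
      BddBelow (range fun b : B => V b + K' * dist w (b : EuclideanSpace ℝ (Fin d))) := by
    intro w
    refine ⟨-C, ?_⟩
    rintro _ ⟨b, rfl⟩
    have h1 := hC b b.2
    rw [Real.norm_eq_abs] at h1
    have h2 : 0 ≤ (K' : ℝ) * dist w b := by positivity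
    linarith [abs_le.1 h1]
  have hattain : ∀ w : EuclideanSpace ℝ (Fin d), ∃ b ∈ B,
      (⨅ b' : B, (V b' + K' * dist w (b' : EuclideanSpace ℝ (Fin d)))) = V b + K' * dist w b := by
    intro w
    obtain ⟨b, hb, hmin⟩ := hB.exists_isMinOn hne (hcont w)
    exact ⟨b, hb, le_antisymm (ciInf_le (hbdd w) ⟨b, hb⟩)
      (le_ciInf fun b' => (isMinOn_iff.1 hmin) b' b'.2)⟩
  refine ⟨fun w => ⨅ b : B, (V b + K' * dist w (b : EuclideanSpace ℝ (Fin d))), ?_,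
    fun w b hb => ciInf_le (hbdd w) ⟨b, hb⟩, hattain⟩
  refine LipschitzWith.of_le_add_mul K' fun w w' => ?_
  obtain ⟨b, hb, hmin⟩ := hattain w'
  show (⨅ b : B, (V b + K' * dist w (b : EuclideanSpace ℝ (Fin d)))) ≤
    (⨅ b : B, (V b + K' * dist w' (b : EuclideanSpace ℝ (Fin d)))) + K' * dist w w'
  rw [hmin]
  calc (⨅ b : B, (V b + K' * dist w (b : EuclideanSpace ℝ (Fin d)))) ≤ V b + K' * dist w b :=
        ciInf_le (hbdd w) ⟨b, hb⟩
    _ ≤ V b + K' * (dist w w' + dist w' b) := by gcongr; exact dist_triangle _ _ _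
    _ = V b + K' * dist w' b + K' * dist w w' := by ring

/-- **The difference-quotient estimate behind K.** With `W` the McShane extension (constant
`K' = 2 K_V + 1`) of a `K_V`-Lipschitz `V` on `B` whose flow-derivative is bounded above by
`g + η` uniformly on `B`, for `y ∈ B`, `‖z‖ < δ` and small `t > 0`:
`W(y + tF(y) − z) − W(y − z) ≤ t (g(y) + 2η + K'K(4δ + Mt))`. Only the flow ON `B` and the
Lipschitz continuity of `F` on `B` enter. [folklore] -/
theorem mcShane_slope_le (hK : LipschitzOnWith K F B)
    (hφ : ∀ b ∈ B, φ b 0 = b ∧ IsForwardTrajectoryIn F B (φ b))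
    {M : ℝ} (hM0 : 0 ≤ M) (hM : ∀ y ∈ B, ‖F y‖ ≤ M)
    {V g W : EuclideanSpace ℝ (Fin d) → ℝ} {KV K' : ℝ≥0} (hK' : (K' : ℝ) = 2 * KV + 1)
    (hV : LipschitzOnWith KV V B)
    (hWle : ∀ w, ∀ b ∈ B, W w ≤ V b + K' * dist w b)
    (hWmin : ∀ w, ∃ b ∈ B, W w = V b + K' * dist w b)
    {η t₀ δ δ₁ : ℝ} (hder : ∀ t ∈ Ioo 0 t₀, ∀ b ∈ B, V (φ b t) - V b ≤ t * (g b + η))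
    (hgu : ∀ b ∈ B, ∀ b' ∈ B, dist b b' < δ₁ → dist (g b) (g b') < η)
    (hδδ₁ : 4 * δ < δ₁) {y z : EuclideanSpace ℝ (Fin d)} (hy : y ∈ B) (hz : ‖z‖ < δ) {t : ℝ}
    (ht : t ∈ Ioo 0 t₀) :
    W (y + t • F y - z) - W (y - z) ≤ t * (g y + 2 * η + K' * K * (4 * δ + M * t)) := by
  obtain ⟨b, hb, hWb⟩ := hWmin (y - z)
  have hK'0 : 0 ≤ (K' : ℝ) := K'.2
  have hKV0 : 0 ≤ (KV : ℝ) := KV.2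
  -- localisation of the minimiser: `dist (y - z) b ≤ 3δ`, hence `dist y b < 4δ < δ₁`
  have hzy : dist (y - z) y < δ := by
    rw [dist_eq_norm, sub_sub_cancel_left, norm_neg]; exact hz
  have h1 : W (y - z) ≤ V y + K' * dist (y - z) y := hWle _ _ hy
  have h2 : V y - V b ≤ KV * dist y b := by
    have := hV.dist_le_mul y hy b hb
    rw [Real.dist_eq] at this
    exact (le_abs_self _).trans this
  have h3 : dist y b ≤ dist (y - z) y + dist (y - z) b := by
    rw [dist_comm (y - z) y]; exact dist_triangle _ _ _
  have hloc : dist (y - z) b ≤ 3 * δ := by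
    rw [hK'] at hWb h1
    nlinarith [dist_nonneg (x := y - z) (y := b), dist_nonneg (x := y - z) (y := y)]
  have hyb : dist y b < 4 * δ := by linarith
  have hgb : g b ≤ g y + η := by
    have := hgu b hb y hy (by rw [dist_comm]; linarith)
    rw [Real.dist_eq] at this
    linarith [(abs_lt.1 this).2]
  -- the upper bound through the true orbit of `b`
  have hbt : φ b t ∈ B := (hφ b hb).2.mem ht.1.le
  have h4 : W (y + t • F y - z) ≤ V (φ b t) + K' * dist (y + t • F y - z) (φ b t) := hWle _ _ hbt
  have h5 : dist (y + t • F y - z) (φ b t) ≤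
      dist (y - z) b + t * (K * dist y b) + K * M * t * t := by
    have e : y + t • F y - z - φ b t =
        (y - z - b) + t • (F y - F b) - (φ b t - φ b 0 - t • F (φ b 0)) := by
      rw [(hφ b hb).1, smul_sub]; abel
    rw [dist_eq_norm, e]
    refine (norm_sub_le _ _).trans ?_
    refine add_le_add ((norm_add_le _ _).trans (add_le_add (by rw [dist_eq_norm]) ?_)) ?_
    · rw [norm_smul, Real.norm_of_nonneg ht.1.le]
      refine mul_le_mul_of_nonneg_left ?_ ht.1.le
      rw [← dist_eq_norm]
      exact hK.dist_le_mul y hy b hb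
    · exact (hφ b hb).2.norm_sub_sub_le hK hM0 hM ht.1.le
  have h6 : V (φ b t) - V b ≤ t * (g b + η) := hder t ht b hb
  have h7 : t * (K * dist y b) ≤ t * (K * (4 * δ)) := by
    have := ht.1.le; have := K.2; gcongr
  calc W (y + t • F y - z) - W (y - z)
      ≤ (V (φ b t) - V b) + K' * (t * (K * (4 * δ)) + K * M * t * t) := by
        rw [hWb]; nlinarith [h4, h5, h7]
    _ ≤ t * (g b + η) + K' * (t * (K * (4 * δ)) + K * M * t * t) := by linarith
    _ ≤ t * (g y + 2 * η) + K' * (t * (K * (4 * δ)) + K * M * t * t) := by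
        nlinarith [ht.1]
    _ = t * (g y + 2 * η + K' * K * (4 * δ + M * t)) := by ring

open scoped Convolution in
/-- **K, abstract core.** Let `ν` be a probability measure carried by `B` with
`∫ F·∇ψ dν = 0` for all smooth compactly supported `ψ`. If `V` is Lipschitz on `B` and its
flow-derivative is bounded above, uniformly on `B`, by a continuous `g` (in the sense of the
hypothesis `hder`), then `∫ g dν ≥ 0`. Proof: mollify the McShane extension of `V`, cut it
off, test stationarity against it and use `mcShane_slope_le`. [folklore] -/
theorem integral_nonneg_of_flowDeriv_le (hF : ContDiff ℝ 1 F) (hB : IsCompact B)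
    (hne : B.Nonempty) (hK : LipschitzOnWith K F B)
    (hφ : ∀ b ∈ B, φ b 0 = b ∧ IsForwardTrajectoryIn F B (φ b))
    {V g : EuclideanSpace ℝ (Fin d) → ℝ} {KV : ℝ≥0} (hV : LipschitzOnWith KV V B)
    (hg : ContinuousOn g B)
    (hder : ∀ η : ℝ, 0 < η → ∃ t₀ : ℝ, 0 < t₀ ∧ ∀ t ∈ Ioo 0 t₀, ∀ b ∈ B,
      V (φ b t) - V b ≤ t * (g b + η))
    {ν : Measure (EuclideanSpace ℝ (Fin d))} [IsProbabilityMeasure ν] (hνB : ν Bᶜ = 0)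
    (hstat : ∀ ψ : EuclideanSpace ℝ (Fin d) → ℝ, ContDiff ℝ (⊤ : ℕ∞) ψ → HasCompactSupport ψ →
      ∫ y, fderiv ℝ ψ y (F y) ∂ν = 0) :
    0 ≤ ∫ y, g y ∂ν := by
  obtain ⟨M, hM0, hM⟩ := exists_forall_norm_le_of_isCompact hF.continuous hB
  obtain ⟨R, hR0, hR⟩ := hB.isBounded.subset_closedBall_lt 0 (0 : EuclideanSpace ℝ (Fin d))
  set K' : ℝ≥0 := 2 * KV + 1 with hK'def
  have hK' : (K' : ℝ) = 2 * KV + 1 := by simp [hK'def]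
  obtain ⟨W, hWlip, hWle, hWmin⟩ := exists_mcShane hB hne hV.continuousOn K'
  refine le_of_forall_pos_le_add fun ε hε => ?_
  -- parameters
  set η : ℝ := ε / 4 with hη
  have hη0 : 0 < η := by positivity
  obtain ⟨t₀, ht₀, hder'⟩ := hder η hη0
  obtain ⟨δ₁, hδ₁, hgu⟩ := Metric.uniformContinuousOn_iff.1
    (hB.uniformContinuousOn_of_continuous hg) η hη0
  obtain ⟨δ, hδ0, hδδ₁, hδη⟩ : ∃ δ : ℝ, 0 < δ ∧ 4 * δ < δ₁ ∧ 4 * K' * K * δ ≤ η := by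
    refine ⟨min (δ₁ / 5) (η / (4 * K' * K + 1)), by positivity, ?_, ?_⟩
    · linarith [min_le_left (δ₁ / 5) (η / (4 * K' * K + 1))]
    · have h1 := min_le_right (δ₁ / 5) (η / (4 * K' * K + 1))
      have h2 : 0 ≤ (4 * K' * K : ℝ) := by positivity
      calc 4 * K' * K * min (δ₁ / 5) (η / (4 * K' * K + 1))
          ≤ 4 * K' * K * (η / (4 * K' * K + 1)) := by gcongr
        _ ≤ η := by
            rw [mul_div_assoc', div_le_iff₀ (by positivity)]
            nlinarith
  -- mollifier, cutoff and the test function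
  let ρ : ContDiffBump (0 : EuclideanSpace ℝ (Fin d)) := ⟨δ / 2, δ, by positivity, by linarith⟩
  let χ : ContDiffBump (0 : EuclideanSpace ℝ (Fin d)) := ⟨R + 1, R + 2, by linarith, by linarith⟩
  set Wδ : EuclideanSpace ℝ (Fin d) → ℝ :=
    ρ.normed volume ⋆[ContinuousLinearMap.lsmul ℝ ℝ, volume] W with hWδ
  have hWδ_smooth : ContDiff ℝ (⊤ : ℕ∞) Wδ :=
    ρ.hasCompactSupport_normed.contDiff_convolution_left _ ρ.contDiff_normed
      hWlip.continuous.locallyIntegrable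
  have hWδ_apply : ∀ w, Wδ w = ∫ z, ρ.normed volume z * W (w - z) := fun w => by
    simp only [hWδ, convolution_lsmul, smul_eq_mul]
  set ψ : EuclideanSpace ℝ (Fin d) → ℝ := fun y => χ y * Wδ y with hψ
  have hψ_smooth : ContDiff ℝ (⊤ : ℕ∞) ψ := χ.contDiff.mul hWδ_smooth
  have hψ_supp : HasCompactSupport ψ := χ.hasCompactSupport.mul_right
  have hψ_eq : ∀ y ∈ B, fderiv ℝ ψ y = fderiv ℝ Wδ y := by
    intro y hy
    apply Filter.EventuallyEq.fderiv_eq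
    have hy1 : y ∈ ball (0 : EuclideanSpace ℝ (Fin d)) (R + 1) := by
      have := hR hy
      rw [mem_closedBall] at this
      rw [mem_ball]
      linarith
    filter_upwards [isOpen_ball.mem_nhds hy1] with w hw
    simp only [hψ]
    rw [χ.one_of_mem_closedBall (ball_subset_closedBall hw), one_mul]
  -- stationarity tested against `ψ`
  have hzero : ∫ y, fderiv ℝ Wδ y (F y) ∂ν = 0 := by
    rw [← hstat ψ hψ_smooth hψ_supp]
    refine integral_congr_ae ((eventually_mem_set.mpr hνB : ∀ᵐ y ∂ν, y ∈ B).mono fun y hy => ?_)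
    simp only [hψ_eq y hy]
  -- the pointwise bound on `B`
  have hpt : ∀ y ∈ B, fderiv ℝ Wδ y (F y) ≤ g y + 3 * η := by
    intro y hy
    have hcurve : HasDerivAt (fun t : ℝ => Wδ (y + t • F y)) (fderiv ℝ Wδ y (F y)) 0 := by
      have h1 : HasDerivAt (fun t : ℝ => y + t • F y) (F y) 0 := by
        simpa using ((hasDerivAt_id (0 : ℝ)).smul_const (F y)).const_add y
      have h2 : HasFDerivAt Wδ (fderiv ℝ Wδ y) (y + (0 : ℝ) • F y) := by
        rw [zero_smul, add_zero]
        exact (hWδ_smooth.differentiable (by simp)).differentiableAt.hasFDerivAt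
      exact h2.comp_hasDerivAt (0 : ℝ) h1
    have hslope := hcurve.tendsto_slope_zero_right
    simp only [zero_add, zero_smul, add_zero] at hslope
    have hintW : ∀ w, Integrable (fun z => ρ.normed volume z * W (w - z)) volume := fun w =>
      (ρ.continuous_normed.mul (hWlip.continuous.comp (continuous_const.sub continuous_id)))
        |>.integrable_of_hasCompactSupport ρ.hasCompactSupport_normed.mul_right
    have hbound : ∀ t ∈ Ioo (0 : ℝ) t₀,
        t⁻¹ * (Wδ (y + t • F y) - Wδ y) ≤ g y + 2 * η + K' * K * (4 * δ + M * t) := by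
      intro t ht
      rw [inv_mul_le_iff₀ ht.1]
      set β : ℝ := g y + 2 * η + K' * K * (4 * δ + M * t) with hβ
      have hkey : ∀ z, ρ.normed volume z * W (y + t • F y - z) - ρ.normed volume z * W (y - z) ≤
          ρ.normed volume z * (t * β) := by
        intro z
        by_cases hz : ‖z‖ < δ
        · rw [← mul_sub]
          exact mul_le_mul_of_nonneg_left
            (mcShane_slope_le hK hφ hM0 hM hK' hV hWle hWmin hder' hgu hδδ₁ hy hz ht)
            (ρ.nonneg_normed z)
        · have h0 : ρ.normed volume z = 0 := by
            rw [← Function.notMem_support, ρ.support_normed_eq]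
            simpa using hz
          simp [h0]
      calc Wδ (y + t • F y) - Wδ y
          = ∫ z, (ρ.normed volume z * W (y + t • F y - z) - ρ.normed volume z * W (y - z)) := by
            rw [hWδ_apply, hWδ_apply, ← integral_sub (hintW _) (hintW _)]
        _ ≤ ∫ z, ρ.normed volume z * (t * β) :=
            integral_mono ((hintW _).sub (hintW _)) (ρ.integrable_normed.mul_const _) hkey
        _ = t * β := by rw [integral_mul_const, ρ.integral_normed, one_mul]
    have hlim : Tendsto (fun t : ℝ => g y + 2 * η + K' * K * (4 * δ + M * t)) (𝓝[>] 0)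
        (𝓝 (g y + 2 * η + K' * K * (4 * δ + M * 0))) :=
      ((continuous_const.add (continuous_const.mul (continuous_const.add
        (continuous_const.mul continuous_id)))).tendsto 0).mono_left nhdsWithin_le_nhds
    have hle := le_of_tendsto_of_tendsto hslope hlim (by
      filter_upwards [Ioo_mem_nhdsGT ht₀] with t ht
      simpa only [smul_eq_mul] using hbound t ht)
    rw [mul_zero, add_zero] at hle
    have : (K' : ℝ) * K * (4 * δ) ≤ η := by linarith
    linarith
  -- integrate
  have hae : ∀ᵐ y ∂ν, y ∈ B := eventually_mem_set.mpr hνB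
  have hint_g : Integrable g ν := integrable_of_continuousOn_of_null hB hνB hg
  have hint_L : Integrable (fun y => fderiv ℝ Wδ y (F y)) ν :=
    integrable_of_continuousOn_of_null hB hνB
      (((hWδ_smooth.continuous_fderiv (by simp)).clm_apply hF.continuous).continuousOn)
  have h1 : ∫ y, fderiv ℝ Wδ y (F y) ∂ν ≤ ∫ y, (g y + 3 * η) ∂ν :=
    integral_mono_ae hint_L (hint_g.add (integrable_const _)) (hae.mono fun y hy => hpt y hy)
  rw [hzero, integral_add hint_g (integrable_const _), integral_const] at h1
  simp only [smul_eq_mul, probReal_univ, one_mul] at h1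
  linarith

/-- Interval integrability on `[a, c] ⊆ [0, ∞)` of a function continuous on `[0, ∞)`.
[folklore] -/
theorem intervalIntegrable_of_continuousOn_Ici {P : ℝ → ℝ} (hP : ContinuousOn P (Ici 0))
    {a c : ℝ} (ha : 0 ≤ a) (hc : 0 ≤ c) : IntervalIntegrable P volume a c :=
  (hP.mono fun _ hs => le_trans (le_min ha hc) hs.1).intervalIntegrable

/-- **The weighted orbit average has a one-sided uniform flow-derivative.** For
`V(b) = ∫₀ᵀ (1 − s/T) Φ(φ_s b) ds` with `Φ` Lipschitz and bounded on `B`,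
`V(φ_t b) − V(b) ≤ t (T⁻¹∫₀ᵀ Φ(φ_s b) ds − Φ(b) + t (4N/T + L_Φ M))` for `t > 0`. [folklore] -/
theorem flowAvg_sub_le (hK : LipschitzOnWith K F B)
    (hφ : ∀ b ∈ B, φ b 0 = b ∧ IsForwardTrajectoryIn F B (φ b))
    {Φ : EuclideanSpace ℝ (Fin d) → ℝ} {LΦ : ℝ≥0} (hΦl : LipschitzOnWith LΦ Φ B)
    (hΦc : ContinuousOn Φ B)
    {N : ℝ} (hN : ∀ y ∈ B, |Φ y| ≤ N) {M : ℝ} (hM0 : 0 ≤ M) (hM : ∀ y ∈ B, ‖F y‖ ≤ M)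
    {T : ℝ} (hT : 0 < T) {b : EuclideanSpace ℝ (Fin d)} (hb : b ∈ B) {t : ℝ} (ht : 0 < t) :
    (∫ s in (0 : ℝ)..T, (1 - s / T) * Φ (φ (φ b t) s)) -
        ∫ s in (0 : ℝ)..T, (1 - s / T) * Φ (φ b s) ≤
      t * ((T⁻¹ * ∫ s in (0 : ℝ)..T, Φ (φ b s)) - Φ b + t * (4 * N / T + LΦ * M)) := by
  have hx := (hφ b hb).2
  set P : ℝ → ℝ := fun s => Φ (φ b s) with hP
  have hPc : ContinuousOn P (Ici 0) := hx.continuousOn_comp hΦc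
  have hwc : Continuous fun u : ℝ => 1 - u / T := by fun_prop
  have hwPc : ContinuousOn (fun u => (1 - u / T) * P u) (Ici 0) := hwc.continuousOn.mul hPc
  have hN0 : 0 ≤ N := (abs_nonneg _).trans (hN b hb)
  have hPN : ∀ u, 0 ≤ u → |P u| ≤ N := fun u hu => hN _ (hx.mem hu)
  have hP0 : P 0 = Φ b := by simp only [hP, (hφ b hb).1]
  have hPlip : ∀ u ∈ Icc 0 t, |P u - Φ b| ≤ LΦ * M * t := by
    intro u hu
    have h1 := hΦl.dist_le_mul _ (hx.mem hu.1) _ hb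
    rw [Real.dist_eq, dist_eq_norm] at h1
    refine h1.trans ?_
    have h2 : ‖φ b u - b‖ ≤ M * u := by
      have := hx.norm_sub_le hM hu.1
      rwa [(hφ b hb).1] at this
    calc (LΦ : ℝ) * ‖φ b u - b‖ ≤ LΦ * (M * u) := by gcongr
      _ ≤ LΦ * (M * t) := by gcongr; exact hu.2
      _ = LΦ * M * t := by ring
  -- Step A: the shifted orbit is the orbit read from time `t`
  have hA : ∫ s in (0 : ℝ)..T, (1 - s / T) * Φ (φ (φ b t) s) =
      ∫ s in (0 : ℝ)..T, (1 - (s + t - t) / T) * P (s + t) := by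
    refine intervalIntegral.integral_congr fun s hs => ?_
    rw [uIcc_of_le hT.le] at hs
    simp only [hP, add_sub_cancel_right, flow_flow hK hφ hb ht.le hs.1]
  -- Step B: change of variables `u = s + t`
  have hB' : ∫ s in (0 : ℝ)..T, (1 - (s + t - t) / T) * P (s + t) =
      ∫ u in t..T + t, (1 - (u - t) / T) * P u := by
    rw [intervalIntegral.integral_comp_add_right (fun u => (1 - (u - t) / T) * P u) t, zero_add]
  -- integrability facts
  have hiP : ∀ a c, 0 ≤ a → 0 ≤ c → IntervalIntegrable P volume a c := fun a c ha hc =>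
    intervalIntegrable_of_continuousOn_Ici hPc ha hc
  have hiwP : ∀ a c, 0 ≤ a → 0 ≤ c →
      IntervalIntegrable (fun u => (1 - u / T) * P u) volume a c := fun a c ha hc =>
    intervalIntegrable_of_continuousOn_Ici hwPc ha hc
  have htT : 0 ≤ T + t := by linarith
  -- Step C: split the shifted weight `1 - (u - t)/T = (1 - u/T) + t/T`
  have hC : ∫ u in t..T + t, (1 - (u - t) / T) * P u =
      (∫ u in t..T + t, (1 - u / T) * P u) + (t / T) * ∫ u in t..T + t, P u := by
    rw [← intervalIntegral.integral_const_mul, ← intervalIntegral.integral_add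
      (hiwP _ _ ht.le htT) ((hiP _ _ ht.le htT).const_mul _)]
    refine intervalIntegral.integral_congr fun u _ => ?_
    ring
  -- Step D: rearrange over adjacent intervals
  have hD1 : (∫ u in t..T + t, (1 - u / T) * P u) - ∫ u in (0 : ℝ)..T, (1 - u / T) * P u =
      (∫ u in T..T + t, (1 - u / T) * P u) - ∫ u in (0 : ℝ)..t, (1 - u / T) * P u := by
    have e1 := intervalIntegral.integral_add_adjacent_intervals (hiwP t T ht.le hT.le)
      (hiwP T (T + t) hT.le htT)
    have e2 := intervalIntegral.integral_add_adjacent_intervals (hiwP 0 t le_rfl ht.le)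
      (hiwP t T ht.le hT.le)
    linarith
  have hD2 : ∫ u in t..T + t, P u =
      (∫ u in (0 : ℝ)..T, P u) - (∫ u in (0 : ℝ)..t, P u) + ∫ u in T..T + t, P u := by
    have e1 := intervalIntegral.integral_add_adjacent_intervals (hiP t T ht.le hT.le)
      (hiP T (T + t) hT.le htT)
    have e2 := intervalIntegral.integral_add_adjacent_intervals (hiP 0 t le_rfl ht.le)
      (hiP t T ht.le hT.le)
    linarith
  -- Step E: bounds on the short pieces
  have hE1 : |∫ u in T..T + t, (1 - u / T) * P u| ≤ t / T * N * t := by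
    have h := intervalIntegral.norm_integral_le_of_norm_le_const (a := T) (b := T + t)
      (f := fun u => (1 - u / T) * P u) (C := t / T * N) fun u hu => by
        rw [uIoc_of_le (by linarith)] at hu
        rw [Real.norm_eq_abs, abs_mul]
        have h1 : |1 - u / T| ≤ t / T := by
          rw [abs_le]
          constructor
          · rw [le_sub_iff_add_le, neg_add_eq_sub, div_sub_div_same, div_le_one hT]
            linarith [hu.2]
          · have : 1 ≤ u / T := by rw [le_div_iff₀ hT]; linarith [hu.1]
            have : 0 ≤ t / T := by positivity
            linarith
        exact mul_le_mul h1 (hPN u (by linarith [hu.1])) (abs_nonneg _) (by positivity)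
    rw [Real.norm_eq_abs] at h
    simpa [abs_of_pos ht] using h
  have hE2 : t * (Φ b - LΦ * M * t - t / T * N) ≤ ∫ u in (0 : ℝ)..t, (1 - u / T) * P u := by
    have h := intervalIntegral.integral_mono_on ht.le intervalIntegrable_const
      (hiwP 0 t le_rfl ht.le) (f := fun _ => Φ b - LΦ * M * t - t / T * N)
      (g := fun u => (1 - u / T) * P u) fun u hu => by
        have h1 := abs_le.1 (hPlip u hu)
        have h2 : |u / T * P u| ≤ t / T * N := by
          rw [abs_mul, abs_of_nonneg (by exact div_nonneg hu.1 hT.le)]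
          exact mul_le_mul (by gcongr; exact hu.2) (hPN u hu.1) (abs_nonneg _) (by positivity)
        have h3 := abs_le.1 h2
        have : (1 - u / T) * P u = P u - u / T * P u := by ring
        rw [this]
        linarith
    rw [intervalIntegral.integral_const, smul_eq_mul, sub_zero] at h
    exact h
  have hE3 : |∫ u in T..T + t, P u| ≤ N * t := by
    have h := intervalIntegral.norm_integral_le_of_norm_le_const (a := T) (b := T + t)
      (f := P) (C := N) fun u hu => by
        rw [uIoc_of_le (by linarith)] at hu
        rw [Real.norm_eq_abs]
        exact hPN u (by linarith [hu.1])
    rw [Real.norm_eq_abs] at h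
    simpa [abs_of_pos ht] using h
  have hE4 : |∫ u in (0 : ℝ)..t, P u| ≤ N * t := by
    have h := intervalIntegral.norm_integral_le_of_norm_le_const (a := 0) (b := t)
      (f := P) (C := N) fun u hu => by
        rw [uIoc_of_le ht.le] at hu
        rw [Real.norm_eq_abs]
        exact hPN u hu.1.le
    rw [Real.norm_eq_abs] at h
    simpa [abs_of_pos ht] using h
  -- assemble
  rw [hA, hB', hC]
  show (∫ u in t..T + t, (1 - u / T) * P u) + t / T * (∫ u in t..T + t, P u) -
      (∫ u in (0 : ℝ)..T, (1 - u / T) * P u) ≤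
      t * ((T⁻¹ * ∫ u in (0 : ℝ)..T, P u) - Φ b + t * (4 * N / T + LΦ * M))
  have a1 := (abs_le.1 hE1).2
  have a3 := (abs_le.1 hE3).2
  have a4 := (abs_le.1 hE4).1
  have htT' : 0 ≤ t / T := by positivity
  set A := ∫ u in (0 : ℝ)..T, P u with hAdef
  set Bv := ∫ u in (0 : ℝ)..t, P u with hBvdef
  set C := ∫ u in T..T + t, P u with hCdef
  rw [hD2]
  have p1 : t / T * C ≤ t / T * (N * t) := mul_le_mul_of_nonneg_left a3 htT'
  have p2 : t / T * (-(N * t)) ≤ t / T * Bv := mul_le_mul_of_nonneg_left a4 htT'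
  have e3 : t * ((T⁻¹ * A) - Φ b + t * (4 * N / T + LΦ * M)) =
      t / T * A - t * Φ b + 4 * (t / T * (N * t)) + t * (LΦ * M * t) := by
    field_simp
    ring
  rw [e3]
  linarith [hD1, a1, hE2, p1, p2]

/-- The weighted orbit average `b ↦ ∫₀ᵀ (1 − s/T) Φ(φ_s b) ds` is Lipschitz on `B`.
[folklore] -/
theorem flowAvg_lipschitzOnWith (hK : LipschitzOnWith K F B)
    (hφ : ∀ b ∈ B, φ b 0 = b ∧ IsForwardTrajectoryIn F B (φ b))
    {Φ : EuclideanSpace ℝ (Fin d) → ℝ} {LΦ : ℝ≥0} (hΦl : LipschitzOnWith LΦ Φ B)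
    (hΦc : ContinuousOn Φ B)
    {T : ℝ} (hT : 0 < T) :
    LipschitzOnWith ⟨T * LΦ * Real.exp (K * T),
        mul_nonneg (mul_nonneg hT.le LΦ.2) (Real.exp_nonneg _)⟩
      (fun b => ∫ s in (0 : ℝ)..T, (1 - s / T) * Φ (φ b s)) B := by
  refine LipschitzOnWith.of_dist_le_mul fun b hb b' hb' => ?_
  have hwc : Continuous fun u : ℝ => 1 - u / T := by fun_prop
  have hi : ∀ c ∈ B, IntervalIntegrable (fun s => (1 - s / T) * Φ (φ c s)) volume 0 T :=
    fun c hc => intervalIntegrable_of_continuousOn_Ici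
      (hwc.continuousOn.mul ((hφ c hc).2.continuousOn_comp hΦc)) le_rfl hT.le
  rw [Real.dist_eq, ← intervalIntegral.integral_sub (hi b hb) (hi b' hb')]
  have h := intervalIntegral.norm_integral_le_of_norm_le_const (a := 0) (b := T)
    (f := fun s => (1 - s / T) * Φ (φ b s) - (1 - s / T) * Φ (φ b' s))
    (C := LΦ * Real.exp (K * T) * dist b b') fun s hs => by
      rw [uIoc_of_le hT.le] at hs
      rw [← mul_sub, Real.norm_eq_abs, abs_mul]
      have h1 : |1 - s / T| ≤ 1 := by
        rw [abs_le]; constructor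
        · have : s / T ≤ 1 := by rw [div_le_one hT]; exact hs.2
          linarith
        · have : 0 ≤ s / T := div_nonneg hs.1.le hT.le
          linarith
      have h2 : |Φ (φ b s) - Φ (φ b' s)| ≤ LΦ * Real.exp (K * T) * dist b b' := by
        have e1 := hΦl.dist_le_mul _ ((hφ b hb).2.mem hs.1.le) _ ((hφ b' hb').2.mem hs.1.le)
        rw [Real.dist_eq] at e1
        refine e1.trans ?_
        have e2 := (hφ b hb).2.dist_le hK (hφ b' hb').2 hs.1.le
        rw [(hφ b hb).1, (hφ b' hb').1] at e2
        calc (LΦ : ℝ) * dist (φ b s) (φ b' s) ≤ LΦ * (dist b b' * Real.exp (K * s)) := by gcongr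
          _ ≤ LΦ * (dist b b' * Real.exp (K * T)) := by gcongr; exact hs.2
          _ = LΦ * Real.exp (K * T) * dist b b' := by ring
      calc |1 - s / T| * |Φ (φ b s) - Φ (φ b' s)| ≤ 1 * (LΦ * Real.exp (K * T) * dist b b') :=
            mul_le_mul h1 h2 (abs_nonneg _) zero_le_one
        _ = _ := one_mul _
  rw [Real.norm_eq_abs, sub_zero, abs_of_pos hT] at h
  refine h.trans (le_of_eq ?_)
  show _ = T * LΦ * Real.exp (K * T) * dist b b'
  ring

/-- **K for Lipschitz observables.** For an Eulerian-stationary probability `ν` on `B`, a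
Lipschitz `Φ` and `T > 0`: if `∫₀ᵀ Φ(φ_s b) ds ≤ Mx` for all `b ∈ B` then `∫ Φ dν ≤ Mx / T`.
[folklore] -/
theorem integral_le_of_orbitIntegral_le_of_lipschitz (hF : ContDiff ℝ 1 F) (hB : IsCompact B)
    (hne : B.Nonempty) (hK : LipschitzOnWith K F B)
    (hφ : ∀ b ∈ B, φ b 0 = b ∧ IsForwardTrajectoryIn F B (φ b))
    {Φ : EuclideanSpace ℝ (Fin d) → ℝ} {LΦ : ℝ≥0} (hΦl : LipschitzOnWith LΦ Φ B)
    (hΦc : ContinuousOn Φ B)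
    {T : ℝ} (hT : 0 < T) {Mx : ℝ} (hMx : ∀ b ∈ B, ∫ s in (0 : ℝ)..T, Φ (φ b s) ≤ Mx)
    {ν : Measure (EuclideanSpace ℝ (Fin d))} [IsProbabilityMeasure ν] (hνB : ν Bᶜ = 0)
    (hstat : ∀ ψ : EuclideanSpace ℝ (Fin d) → ℝ, ContDiff ℝ (⊤ : ℕ∞) ψ → HasCompactSupport ψ →
      ∫ y, fderiv ℝ ψ y (F y) ∂ν = 0) :
    ∫ y, Φ y ∂ν ≤ Mx / T := by
  obtain ⟨M, hM0, hM⟩ := exists_forall_norm_le_of_isCompact hF.continuous hB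
  obtain ⟨N, hN'⟩ := hB.exists_bound_of_continuousOn hΦc
  have hN : ∀ y ∈ B, |Φ y| ≤ N := fun y hy => by simpa [Real.norm_eq_abs] using hN' y hy
  set V : EuclideanSpace ℝ (Fin d) → ℝ := fun b => ∫ s in (0 : ℝ)..T, (1 - s / T) * Φ (φ b s)
    with hVdef
  set g : EuclideanSpace ℝ (Fin d) → ℝ := fun b => (T⁻¹ * ∫ s in (0 : ℝ)..T, Φ (φ b s)) - Φ b
    with hgdef
  have hV : LipschitzOnWith ⟨T * LΦ * Real.exp (K * T),
      mul_nonneg (mul_nonneg hT.le LΦ.2) (Real.exp_nonneg _)⟩ V B :=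
    flowAvg_lipschitzOnWith hK hφ hΦl hΦc hT
  have hIc : ContinuousOn (fun b => ∫ s in (0 : ℝ)..T, Φ (φ b s)) B :=
    continuousOn_integral_flow hB hK hφ hΦc le_rfl hT.le
  have hg : ContinuousOn g B := (continuousOn_const.mul hIc).sub hΦc
  have hder : ∀ η : ℝ, 0 < η → ∃ t₀ : ℝ, 0 < t₀ ∧ ∀ t ∈ Ioo 0 t₀, ∀ b ∈ B,
      V (φ b t) - V b ≤ t * (g b + η) := by
    intro η hη
    have hc0 : 0 ≤ 4 * N / T + LΦ * M := by
      have : 0 ≤ N := (abs_nonneg _).trans (hN _ hne.some_mem)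
      positivity
    refine ⟨η / (4 * N / T + LΦ * M + 1), by positivity, fun t ht b hb => ?_⟩
    have h1 := flowAvg_sub_le hK hφ hΦl hΦc hN hM0 hM hT hb ht.1
    refine h1.trans (mul_le_mul_of_nonneg_left ?_ ht.1.le)
    show _ ≤ (T⁻¹ * ∫ s in (0 : ℝ)..T, Φ (φ b s)) - Φ b + η
    have h2 : t * (4 * N / T + LΦ * M) ≤ η := by
      have h3 : t * (4 * N / T + LΦ * M) ≤ η / (4 * N / T + LΦ * M + 1) * (4 * N / T + LΦ * M) :=
        mul_le_mul_of_nonneg_right ht.2.le hc0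
      refine h3.trans ?_
      rw [div_mul_eq_mul_div, div_le_iff₀ (by positivity)]
      nlinarith
    linarith
  have h0 := integral_nonneg_of_flowDeriv_le hF hB hne hK hφ hV hg hder hνB hstat
  -- unfold `∫ g = T⁻¹ ∫ I - ∫ Φ` and bound `∫ I ≤ Mx`
  have hae : ∀ᵐ y ∂ν, y ∈ B := eventually_mem_set.mpr hνB
  have hint_I : Integrable (fun b => ∫ s in (0 : ℝ)..T, Φ (φ b s)) ν :=
    integrable_of_continuousOn_of_null hB hνB hIc
  have hint_Φ : Integrable Φ ν := integrable_of_continuousOn_of_null hB hνB hΦc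
  have h1 : ∫ y, g y ∂ν = T⁻¹ * (∫ b, (∫ s in (0 : ℝ)..T, Φ (φ b s)) ∂ν) - ∫ y, Φ y ∂ν := by
    show ∫ y, ((T⁻¹ * ∫ s in (0 : ℝ)..T, Φ (φ y s)) - Φ y) ∂ν = _
    rw [integral_sub (hint_I.const_mul _) hint_Φ, integral_const_mul]
  have h2 : ∫ b, (∫ s in (0 : ℝ)..T, Φ (φ b s)) ∂ν ≤ Mx := by
    have := integral_mono_ae hint_I (integrable_const Mx) (hae.mono fun b hb => hMx b hb)
    simpa using this
  rw [h1] at h0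
  have h3 : T⁻¹ * (∫ b, (∫ s in (0 : ℝ)..T, Φ (φ b s)) ∂ν) ≤ T⁻¹ * Mx :=
    mul_le_mul_of_nonneg_left h2 (inv_nonneg.2 hT.le)
  rw [div_eq_inv_mul]
  linarith

/-- **K (Tobasco–Goluskin–Doering 2018, the content of (11)–(12) that the proof of (10a)–(10b)
needs): Eulerian stationarity bounds `∫ Φ dν` by the best finite-time orbit average.** For an
Eulerian-stationary probability `ν` carried by `B`, a continuous `Φ` and `T > 0`: if
`∫₀ᵀ Φ(φ_s b) ds ≤ Mx` for every `b ∈ B` then `∫ Φ dν ≤ Mx / T`.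
[cite: TobascoGoluskinDoering2018, §5 (11)–(12)] -/
theorem integral_le_of_orbitIntegral_le (hF : ContDiff ℝ 1 F) (hB : IsCompact B)
    (hne : B.Nonempty) (hK : LipschitzOnWith K F B)
    (hφ : ∀ b ∈ B, φ b 0 = b ∧ IsForwardTrajectoryIn F B (φ b))
    {Φ : EuclideanSpace ℝ (Fin d) → ℝ} (hΦ : Continuous Φ)
    {T : ℝ} (hT : 0 < T) {Mx : ℝ} (hMx : ∀ b ∈ B, ∫ s in (0 : ℝ)..T, Φ (φ b s) ≤ Mx)
    {ν : Measure (EuclideanSpace ℝ (Fin d))} [IsProbabilityMeasure ν] (hνB : ν Bᶜ = 0)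
    (hstat : ∀ ψ : EuclideanSpace ℝ (Fin d) → ℝ, ContDiff ℝ (⊤ : ℕ∞) ψ → HasCompactSupport ψ →
      ∫ y, fderiv ℝ ψ y (F y) ∂ν = 0) :
    ∫ y, Φ y ∂ν ≤ Mx / T := by
  refine le_of_forall_pos_le_add fun ε hε => ?_
  set ε' : ℝ := ε / 2 with hε'
  have hε'0 : 0 < ε' := by positivity
  -- a smooth `Φ̃` with `|Φ̃ - Φ| ≤ ε'` on `B`
  have hB₁ : IsCompact (cthickening 1 B) := hB.cthickening
  obtain ⟨r₀, hr₀, hru⟩ := Metric.uniformContinuousOn_iff.1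
    (hB₁.uniformContinuousOn_of_continuous hΦ.continuousOn) ε' hε'0
  set r : ℝ := min r₀ 1 with hr
  have hrpos : 0 < r := by positivity
  obtain ⟨Φ', hΦ's, hΦ'⟩ := hΦ.exists_contDiff_dist_le_of_forall_mem_ball_dist_le hrpos
  have happrox : ∀ a ∈ B, |Φ' a - Φ a| ≤ ε' := by
    intro a ha
    rw [← Real.dist_eq]
    refine hΦ' a ε' fun y hy => le_of_lt (hru y ?_ a (self_subset_cthickening _ ha) ?_)
    · rw [mem_ball] at hy
      exact mem_cthickening_of_dist_le y a 1 B ha (by linarith [min_le_right r₀ 1])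
    · exact lt_of_lt_of_le (mem_ball.1 hy) (min_le_left _ _)
  obtain ⟨LΦ, hΦ'l⟩ := exists_lipschitzOnWith_of_contDiff (hΦ's.of_le (mod_cast le_top)) hB
  have hΦ'c : ContinuousOn Φ' B := hΦ's.continuous.continuousOn
  -- orbit integrals of `Φ̃`
  have hMx' : ∀ b ∈ B, ∫ s in (0 : ℝ)..T, Φ' (φ b s) ≤ Mx + T * ε' := by
    intro b hb
    have hx := (hφ b hb).2
    have h := intervalIntegral.integral_mono_on hT.le (hx.intervalIntegrable_comp hΦ'c le_rfl hT.le)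
      ((hx.intervalIntegrable_comp hΦ.continuousOn le_rfl hT.le).add intervalIntegrable_const)
      (g := fun s => Φ (φ b s) + ε') fun s hs => by
        linarith [(abs_le.1 (happrox _ (hx.mem hs.1))).2]
    rw [intervalIntegral.integral_add (hx.intervalIntegrable_comp hΦ.continuousOn le_rfl hT.le)
      intervalIntegrable_const, intervalIntegral.integral_const, smul_eq_mul, sub_zero] at h
    linarith [hMx b hb]
  have h1 := integral_le_of_orbitIntegral_le_of_lipschitz hF hB hne hK hφ hΦ'l hΦ'c hT hMx'
    hνB hstat
  -- compare `∫ Φ` with `∫ Φ̃`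
  have hae : ∀ᵐ y ∂ν, y ∈ B := eventually_mem_set.mpr hνB
  have hint_Φ : Integrable Φ ν := integrable_of_continuousOn_of_null hB hνB hΦ.continuousOn
  have hint_Φ' : Integrable Φ' ν := integrable_of_continuousOn_of_null hB hνB hΦ'c
  have h2 : ∫ y, Φ y ∂ν ≤ ∫ y, (Φ' y + ε') ∂ν :=
    integral_mono_ae hint_Φ (hint_Φ'.add (integrable_const _)) (hae.mono fun y hy => by
      linarith [(abs_le.1 (happrox y hy)).1])
  rw [integral_add hint_Φ' (integrable_const _), integral_const] at h2
  simp only [smul_eq_mul, probReal_univ, one_mul] at h2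
  have h3 : (Mx + T * ε') / T = Mx / T + ε' := by field_simp
  rw [h3] at h1
  linarith

end EulerianToLagrangian

section MaximalOrbit

/-! ### E — an orbit whose running integrals stay bounded below -/

variable {F : EuclideanSpace ℝ (Fin d) → EuclideanSpace ℝ (Fin d)}
  {B : Set (EuclideanSpace ℝ (Fin d))} {K : ℝ≥0}
  {φ : EuclideanSpace ℝ (Fin d) → ℝ → EuclideanSpace ℝ (Fin d)}

/-- **E (replacing extreme points + Birkhoff in the proof of (10a)).** If for every `T > 0` some
orbit in `B` has `∫₀ᵀ f(φ_s b) ds ≥ 0`, then some orbit has all its running integrals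
`∫₀ᵀ f(φ_s b) ds`, `T ≥ 0`, bounded below: otherwise every point has a time `≤ T*` at which the
running integral drops below `−1` (compactness), and iterating along one orbit contradicts the
hypothesis at a large time. [folklore] -/
theorem exists_orbit_integral_bounded_below (hB : IsCompact B) (hne : B.Nonempty)
    (hK : LipschitzOnWith K F B) (hφ : ∀ b ∈ B, φ b 0 = b ∧ IsForwardTrajectoryIn F B (φ b))
    {f : EuclideanSpace ℝ (Fin d) → ℝ} (hf : ContinuousOn f B)
    (hpos : ∀ T : ℝ, 0 < T → ∃ b ∈ B, 0 ≤ ∫ s in (0 : ℝ)..T, f (φ b s)) :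
    ∃ b ∈ B, ∃ C : ℝ, ∀ T : ℝ, 0 ≤ T → -C ≤ ∫ s in (0 : ℝ)..T, f (φ b s) := by
  classical
  by_contra hcon
  push Not at hcon
  obtain ⟨Cf, hCf'⟩ := hB.exists_bound_of_continuousOn hf
  have hCf : ∀ y ∈ B, |f y| ≤ Cf := fun y hy => by simpa [Real.norm_eq_abs] using hCf' y hy
  have hCf0 : 0 ≤ Cf := (abs_nonneg _).trans (hCf _ hne.some_mem)
  set I : ℝ → EuclideanSpace ℝ (Fin d) → ℝ := fun T b => ∫ s in (0 : ℝ)..T, f (φ b s) with hI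
  have hIabs : ∀ b ∈ B, ∀ T, 0 ≤ T → |I T b| ≤ Cf * T := by
    intro b hb T hT
    have h := intervalIntegral.norm_integral_le_of_norm_le_const (a := 0) (b := T) (C := Cf)
      (f := fun s => f (φ b s)) fun s hs => by
        rw [uIoc_of_le hT] at hs
        simpa [Real.norm_eq_abs] using hCf _ ((hφ b hb).2.mem hs.1.le)
    simpa [hI, Real.norm_eq_abs, abs_of_nonneg hT] using h
  -- Step 1: a uniform time `T*`
  have hstep : ∃ Tstar : ℝ, 0 < Tstar ∧ ∀ b ∈ B, ∃ T ∈ Icc (0 : ℝ) Tstar, I T b < -1 := by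
    have hnb : ∀ b ∈ B, ∃ T : ℝ, 0 ≤ T ∧ ∃ U ∈ 𝓝 b, ∀ b' ∈ U ∩ B, I T b' < -1 := by
      intro b hb
      obtain ⟨T, hT0, hTb⟩ := hcon b hb 1
      have hc : ContinuousOn (I T) B := continuousOn_integral_flow hB hK hφ hf le_rfl hT0
      obtain ⟨U, hU, hUsub⟩ := mem_nhdsWithin_iff_exists_mem_nhds_inter.1
        ((hc b hb).preimage_mem_nhdsWithin (Iio_mem_nhds hTb))
      exact ⟨T, hT0, U, hU, fun b' hb' => hUsub hb'⟩
    choose! Tb hTb0 Ub hUb hIU using hnb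
    obtain ⟨t, htB, hcover⟩ := hB.elim_nhds_subcover Ub fun b hb => hUb b hb
    refine ⟨1 + ∑ b ∈ t, Tb b, ?_, fun b' hb' => ?_⟩
    · have : 0 ≤ ∑ b ∈ t, Tb b := Finset.sum_nonneg fun b hb => hTb0 b (htB b hb)
      linarith
    · obtain ⟨b, hbt, hb'U⟩ := mem_iUnion₂.1 (hcover hb')
      refine ⟨Tb b, ⟨hTb0 b (htB b hbt), ?_⟩, hIU b (htB b hbt) b' ⟨hb'U, hb'⟩⟩
      have : Tb b ≤ ∑ b ∈ t, Tb b :=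
        Finset.single_le_sum (fun b hb => hTb0 b (htB b hb)) hbt
      linarith
  obtain ⟨Tstar, hTstar, hstep'⟩ := hstep
  choose! Δ hΔ hIΔ using hstep'
  -- Step 2: a long horizon and the orbit promised by `hpos`
  set Tbig : ℝ := Tstar * (Tstar * Cf + 2) with hTbig
  have hTbig0 : 0 < Tbig := by positivity
  obtain ⟨b, hb, hbpos⟩ := hpos Tbig hTbig0
  have hbpos' : 0 ≤ I Tbig b := hbpos
  have hx := (hφ b hb).2
  -- stopping times along the orbit of `b`
  let τ : ℕ → ℝ := fun n => Nat.rec (motive := fun _ => ℝ) 0 (fun _ τk => τk + Δ (φ b τk)) n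
  have hτ0 : τ 0 = 0 := rfl
  have hτs : ∀ k, τ (k + 1) = τ k + Δ (φ b (τ k)) := fun k => rfl
  have hτnn : ∀ k, 0 ≤ τ k := by
    intro k
    induction k with
    | zero => simp [hτ0]
    | succ k ih => rw [hτs]; exact add_nonneg ih (hΔ _ (hx.mem ih)).1
  have hτle : ∀ k : ℕ, τ k ≤ k * Tstar := by
    intro k
    induction k with
    | zero => simp [hτ0]
    | succ k ih =>
      rw [hτs]; push_cast
      linarith [(hΔ _ (hx.mem (hτnn k))).2]
  have hIτ : ∀ k : ℕ, I (τ k) b ≤ -k := by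
    intro k
    induction k with
    | zero => simp [hτ0, hI]
    | succ k ih =>
      have hk := hτnn k
      have hmem : φ b (τ k) ∈ B := hx.mem hk
      have hΔk := hΔ _ hmem
      have hsplit : I (τ (k + 1)) b = I (τ k) b + I (Δ (φ b (τ k))) (φ b (τ k)) := by
        simp only [hI, hτs]
        rw [← intervalIntegral.integral_add_adjacent_intervals (b := τ k)
          (hx.intervalIntegrable_comp hf le_rfl hk)
          (hx.intervalIntegrable_comp hf hk (add_nonneg hk hΔk.1))]
        congr 1
        have e1 : ∫ s in (0 : ℝ)..Δ (φ b (τ k)), f (φ (φ b (τ k)) s) =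
            ∫ s in (0 : ℝ)..Δ (φ b (τ k)), f (φ b (s + τ k)) := by
          refine intervalIntegral.integral_congr fun s hs => ?_
          rw [uIcc_of_le hΔk.1] at hs
          simp only [flow_flow hK hφ hb hk hs.1]
        rw [e1, intervalIntegral.integral_comp_add_right (fun u => f (φ b u)), zero_add,
          add_comm (Δ (φ b (τ k))) (τ k)]
      have := hIΔ _ hmem
      rw [hsplit]
      push_cast
      linarith
  -- `Cf > 0` and the orbit eventually passes `Tbig`
  have hCfpos : 0 < Cf := by
    have h1 := hIΔ b hb
    have h2 := (abs_le.1 (hIabs b hb (Δ b) (hΔ b hb).1)).1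
    by_contra hle
    push Not at hle
    have : Cf * Δ b ≤ 0 := mul_nonpos_of_nonpos_of_nonneg hle (hΔ b hb).1
    linarith
  have hex : ∃ k : ℕ, Tbig < τ k := by
    obtain ⟨k, hk⟩ := exists_nat_gt (Cf * Tbig)
    refine ⟨k, lt_of_not_ge fun hle => ?_⟩
    have h1 := hIτ k
    have h2 := (abs_le.1 (hIabs b hb (τ k) (hτnn k))).1
    have h4 : Cf * τ k ≤ Cf * Tbig := mul_le_mul_of_nonneg_left hle hCf0
    linarith
  let k₀ := Nat.find hex
  have hk₀ : Tbig < τ k₀ := Nat.find_spec hex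
  have hk₀pos : k₀ ≠ 0 := by
    intro h0
    have h1 : Tbig < τ 0 := by rw [← h0]; exact hk₀
    rw [hτ0] at h1
    linarith
  obtain ⟨k, hk⟩ : ∃ k, k₀ = k + 1 := Nat.exists_eq_succ_of_ne_zero hk₀pos
  have hkle : τ k ≤ Tbig := le_of_not_gt (Nat.find_min hex (show k < k₀ by omega))
  have hklt : Tbig < τ (k + 1) := by rw [← hk]; exact hk₀
  -- the contradiction at time `Tbig`
  have hsplit : I Tbig b = I (τ k) b + ∫ s in τ k..Tbig, f (φ b s) := by
    simp only [hI]
    rw [intervalIntegral.integral_add_adjacent_intervals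
      (hx.intervalIntegrable_comp hf le_rfl (hτnn k))
      (hx.intervalIntegrable_comp hf (hτnn k) hTbig0.le)]
  have htail : |∫ s in τ k..Tbig, f (φ b s)| ≤ Cf * (Tbig - τ k) := by
    have h := intervalIntegral.norm_integral_le_of_norm_le_const (a := τ k) (b := Tbig)
      (C := Cf) (f := fun s => f (φ b s)) fun s hs => by
        rw [uIoc_of_le hkle] at hs
        simpa [Real.norm_eq_abs] using hCf _ (hx.mem ((hτnn k).trans hs.1.le))
    rw [Real.norm_eq_abs, abs_of_nonneg (sub_nonneg.2 hkle)] at h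
    exact h
  have hΔk := hΔ _ (hx.mem (hτnn k))
  have h1 : Tbig - τ k ≤ Tstar := by
    have := hτs k
    linarith [hΔk.2]
  have h2 : Tstar * Cf + 2 < (k : ℝ) + 1 := by
    have h3 := hτle (k + 1)
    push_cast at h3
    have h4 : Tstar * (Tstar * Cf + 2) < ((k : ℝ) + 1) * Tstar := by
      have : Tbig = Tstar * (Tstar * Cf + 2) := hTbig
      linarith
    nlinarith
  have h5 := (abs_le.1 htail).2
  have h6 : Cf * (Tbig - τ k) ≤ Cf * Tstar := mul_le_mul_of_nonneg_left h1 hCf0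
  have h7 := hIτ k
  rw [hsplit] at hbpos'
  linarith

end MaximalOrbit

section Main

/-! ### G — assembling the named fact -/

/-- **Discharge of `TobascoGoluskinDoering2018_measureForm`** (Tobasco–Goluskin–Doering 2018,
eq. (8) with attainment, (10a) and the Eulerian stationarity (11)): with
`m = inf_{V ∈ C¹(B)} sup_B (Φ + F·∇V)`, weak duality (W) bounds every long-time average and —
through K — every stationary average by `m`; Hahn–Banach + Riesz–Markov–Kakutani (H) produce a
stationary probability measure with `∫Φ dμ = m`; K then shows `max_b ∫₀ᵀ (Φ − m)(φ_s b) ds ≥ 0`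
for all `T`, so by E some orbit has time averages converging to `m`; and `m` is the greatest
lower bound of the auxiliary-function bounds by construction.
[cite: TobascoGoluskinDoering2018, eq. (8), §5 (10a)–(10d), (11)] -/
theorem TobascoGoluskinDoering2018_measureForm_holds : TobascoGoluskinDoering2018_measureForm := by
  intro d F B Φ hF hΦ hB hne htraj
  classical
  have hFc : Continuous F := hF.continuous
  obtain ⟨K, hK⟩ := exists_lipschitzOnWith_of_contDiff hF hB
  obtain ⟨b₀, hb₀⟩ := hne
  -- H: a stationary probability measure realising the dual value
  obtain ⟨μ, hμ, hμB, hμstat, hμΦ⟩ := exists_stationaryMeasure hF hB ⟨b₀, hb₀⟩ htraj hΦ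
  have hμstat' : ∀ ψ : EuclideanSpace ℝ (Fin d) → ℝ, ContDiff ℝ (⊤ : ℕ∞) ψ → HasCompactSupport ψ →
      ∫ y, fderiv ℝ ψ y (F y) ∂μ = 0 := fun ψ hψ _ =>
    hμstat ψ (isC1Near_of_contDiff hψ (mod_cast le_top))
  -- the flow on `B`
  choose! φ hφ0 hφtraj using htraj
  have hφ : ∀ b ∈ B, φ b 0 = b ∧ IsForwardTrajectoryIn F B (φ b) := fun b hb =>
    ⟨hφ0 b hb, hφtraj b hb⟩
  -- the dual value `m`
  set Bset : Set ℝ :=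
    {r : ℝ | ∃ V : EuclideanSpace ℝ (Fin d) → ℝ, IsC1Near B V ∧ auxBound F B Φ V = r} with hBset
  set m : ℝ := sInf Bset with hm
  have hBne : Bset.Nonempty := ⟨_, 0, isC1Near_zero, rfl⟩
  have hlow : ∀ x, IsForwardTrajectoryIn F B x → timeAvgLimsup Φ x ≤ m := fun x hx =>
    le_csInf hBne (by
      rintro _ ⟨V, hV, rfl⟩
      exact hx.timeAvgLimsup_le_auxBound hB hV hFc hΦ.continuousOn)
  have hBbdd : BddBelow Bset := ⟨timeAvgLimsup Φ (φ b₀), by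
    rintro _ ⟨V, hV, rfl⟩
    exact (hφ b₀ hb₀).2.timeAvgLimsup_le_auxBound hB hV hFc hΦ.continuousOn⟩
  have hGLB : IsGLB Bset m := isGLB_csInf hBne hBbdd
  -- K: every Eulerian-stationary probability on `B` has `∫ Φ dν ≤ m`
  have hK_all : ∀ ν : Measure (EuclideanSpace ℝ (Fin d)), IsProbabilityMeasure ν → ν Bᶜ = 0 →
      (∀ ψ : EuclideanSpace ℝ (Fin d) → ℝ, ContDiff ℝ (⊤ : ℕ∞) ψ → HasCompactSupport ψ →
        ∫ y, fderiv ℝ ψ y (F y) ∂ν = 0) →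
      ∫ y, Φ y ∂ν ≤ m := by
    intro ν hν hνB hstat
    refine le_csInf hBne ?_
    rintro _ ⟨V, hV, rfl⟩
    obtain ⟨N, hN⟩ := hV.exists_forall_abs_le hB
    have hN0 : 0 ≤ N := (abs_nonneg _).trans (hN _ hb₀)
    refine le_of_forall_pos_le_add fun ε hε => ?_
    set T : ℝ := 2 * N / ε + 1 with hT
    have hTpos : 0 < T := by positivity
    have hMx : ∀ b ∈ B, ∫ s in (0 : ℝ)..T, Φ (φ b s) ≤ T * auxBound F B Φ V + 2 * N := by
      intro b hb
      have h := (hφ b hb).2.integral_le_auxBound hB hV hFc hΦ.continuousOn hTpos.le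
      have h1 := hN _ ((hφ b hb).2.mem le_rfl)
      have h2 := hN _ ((hφ b hb).2.mem hTpos.le)
      linarith [abs_le.1 h1, abs_le.1 h2]
    have h := integral_le_of_orbitIntegral_le hF hB ⟨b₀, hb₀⟩ hK hφ hΦ hTpos hMx hνB hstat
    have h3 : (T * auxBound F B Φ V + 2 * N) / T = auxBound F B Φ V + 2 * N / T := by
      field_simp
    have h4 : 2 * N / T ≤ ε := by
      rw [div_le_iff₀ hTpos, hT]
      have : ε * (2 * N / ε + 1) = 2 * N + ε := by field_simp
      linarith
    linarith
  -- E: an orbit whose time averages converge to `m`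
  have hpos : ∀ T : ℝ, 0 < T → ∃ b ∈ B, 0 ≤ ∫ s in (0 : ℝ)..T, (Φ (φ b s) - m) := by
    intro T hT
    by_contra hneg
    push Not at hneg
    have hfc : ContinuousOn (fun y => Φ y - m) B := hΦ.continuousOn.sub continuousOn_const
    have hIc : ContinuousOn (fun b => ∫ s in (0 : ℝ)..T, (Φ (φ b s) - m)) B :=
      continuousOn_integral_flow hB hK hφ hfc le_rfl hT.le
    obtain ⟨bm, hbm, hmax⟩ := hB.exists_isMaxOn ⟨b₀, hb₀⟩ hIc
    have hMxneg : ∫ s in (0 : ℝ)..T, (Φ (φ bm s) - m) < 0 := hneg bm hbm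
    have hMx : ∀ b ∈ B, ∫ s in (0 : ℝ)..T, Φ (φ b s) ≤
        (∫ s in (0 : ℝ)..T, (Φ (φ bm s) - m)) + T * m := by
      intro b hb
      have h1 : ∫ s in (0 : ℝ)..T, (Φ (φ b s) - m) ≤ ∫ s in (0 : ℝ)..T, (Φ (φ bm s) - m) :=
        isMaxOn_iff.1 hmax b hb
      have h2 : ∫ s in (0 : ℝ)..T, (Φ (φ b s) - m) = (∫ s in (0 : ℝ)..T, Φ (φ b s)) - T * m := by
        rw [intervalIntegral.integral_sub ((hφ b hb).2.intervalIntegrable_comp hΦ.continuousOn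
          le_rfl hT.le) intervalIntegrable_const, intervalIntegral.integral_const, smul_eq_mul,
          sub_zero]
      linarith
    have h := integral_le_of_orbitIntegral_le hF hB ⟨b₀, hb₀⟩ hK hφ hΦ hT hMx hμB hμstat'
    rw [hμΦ] at h
    have e : ((∫ s in (0 : ℝ)..T, (Φ (φ bm s) - m)) + T * m) / T =
        (∫ s in (0 : ℝ)..T, (Φ (φ bm s) - m)) / T + m := by
      field_simp
    rw [e] at h
    have : (∫ s in (0 : ℝ)..T, (Φ (φ bm s) - m)) / T < 0 := div_neg_of_neg_of_pos hMxneg hT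
    linarith
  obtain ⟨b, hb, C, hC⟩ := exists_orbit_integral_bounded_below hB ⟨b₀, hb₀⟩ hK hφ
    (f := fun y => Φ y - m) (hΦ.continuousOn.sub continuousOn_const) hpos
  have hxb := (hφ b hb).2
  have havg : ∀ T : ℝ, 0 < T → m - C / T ≤ T⁻¹ * ∫ s in (0 : ℝ)..T, Φ (φ b s) := by
    intro T hT
    have h1 := hC T hT.le
    have h2 : ∫ s in (0 : ℝ)..T, (fun y => Φ y - m) (φ b s) =
        (∫ s in (0 : ℝ)..T, Φ (φ b s)) - T * m := by
      show ∫ s in (0 : ℝ)..T, (Φ (φ b s) - m) = _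
      rw [intervalIntegral.integral_sub (hxb.intervalIntegrable_comp hΦ.continuousOn le_rfl hT.le)
        intervalIntegrable_const, intervalIntegral.integral_const, smul_eq_mul, sub_zero]
    rw [h2] at h1
    rw [le_inv_mul_iff₀ hT]
    have e : T * (m - C / T) = T * m - C := by field_simp
    rw [e]
    linarith
  have hge : m ≤ timeAvgLimsup Φ (φ b) := by
    obtain ⟨CΦ, hCΦ'⟩ := hB.exists_bound_of_continuousOn hΦ.continuousOn
    have hCΦ : ∀ y ∈ B, |Φ y| ≤ CΦ := fun y hy => by simpa [Real.norm_eq_abs] using hCΦ' y hy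
    have hbdd : IsBoundedUnder (· ≤ ·) atTop fun T : ℝ => T⁻¹ * ∫ t in (0 : ℝ)..T, Φ (φ b t) :=
      ⟨CΦ, by
        rw [eventually_map]
        filter_upwards [eventually_gt_atTop 0] with T hT
        exact (abs_le.1 (hxb.abs_timeAvg_le hCΦ hT)).2⟩
    refine le_of_forall_pos_le_add fun ε hε => ?_
    have hle : m - ε ≤ timeAvgLimsup Φ (φ b) := by
      refine le_limsup_of_frequently_le (Eventually.frequently ?_) hbdd
      filter_upwards [eventually_gt_atTop 0, eventually_ge_atTop (|C| / ε + 1)] with T hT hT2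
      have h1 := havg T hT
      have h2 : C / T ≤ ε := by
        rw [div_le_iff₀ hT]
        have h3 : C ≤ |C| := le_abs_self C
        have h4 : ε * (|C| / ε + 1) ≤ ε * T := mul_le_mul_of_nonneg_left hT2 hε.le
        have h5 : ε * (|C| / ε + 1) = |C| + ε := by field_simp
        linarith
      linarith
    linarith
  have heq : timeAvgLimsup Φ (φ b) = m := le_antisymm (hlow _ hxb) hge
  refine ⟨m, ⟨⟨φ b, hxb, heq⟩, ?_⟩, ⟨⟨μ, hμ, hμB, hμstat', hμΦ⟩, ?_⟩, hGLB⟩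
  · rintro _ ⟨x, hx, rfl⟩
    exact hlow x hx
  · rintro _ ⟨ν, hν, hνB, hstat, rfl⟩
    exact hK_all ν hν hνB hstat

end Main

end Literature.Dynamics.Ergodic
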